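import Literature.Probability.RandomMatrixProducts.AndersonModel1DContinuityBasics
import Mathlib.Analysis.Normed.Lp.MeasurableSpace
import Mathlib.MeasureTheory.Measure.Prokhorov
import Mathlib.MeasureTheory.Measure.LevyProkhorovMetric
import Mathlib.MeasureTheory.Integral.BoundedContinuousFunction
import HarnessLib

/-!
# Continuity of the Lyapunov exponent of the Anderson model, II: stationary measures on the circle

Companion to `AndersonModel1D.lean` and `AndersonModel1DContinuityBasics.lean`
(Bucaj–Damanik–Fillman–Gerbuz–VandenBoom–Wang–Zhang, TAMS **372** (2019) 3619–3667,
arXiv:1706.06135, §2).  Everything here is PROVED.  This is the measure-theoretic heart of the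
discharge of `BucajEtAl2019_lyapunovContinuous` (Thm 2.6 there), namely the part of the
Fürstenberg–Kifer theorem (Thm 2.5 there) that the Anderson model needs, proved from scratch by an
elementary route (no Oseledets, Kingman or martingale input):

* **Geometry of the circle** `𝕊¹ ⊂ ℝ²`: the wedge `v ∧ u`, Lagrange's identity, the *pair
  inequality* `|v ∧ v'| ‖X‖ ≤ ‖Xv‖ + ‖Xv'‖`, hence the vectors contracted by `X` below `‖X‖s/2`
  lie in ONE thin double cone `{|v ∧ u| < s}`;
* non-atomic finite measures on the circle give uniformly small mass to thin double cones
  (`exists_forall_measure_wedge_lt_le`, compactness);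
* the Markov structure of the directions `M_n v/‖M_n v‖`: one-step identities for the orbit laws
  (`integral_orbit_logNormOne`, `integral_orbit_transition`) and, for a STATIONARY probability
  measure `m` (`act_*(μ ⊗ m) = m`, `act(a, w) = M(a)w/‖M(a)w‖`), the invariance identity
  `∫ g_n dm = n ∫ g_1 dm` (`integral_logNorm_eq_mul_of_stationary`; `g_n(w) = 𝔼 log ‖M_n w‖`);
* **Fürstenberg's lemma** for the Anderson matrices: if the site law charges two points `a₀ ≠ b₀`
  of its support, stationary measures have NO atoms (`measure_singleton_eq_zero_of_stationary`) —
  the maximal atoms form a finite set invariant under the shears `M(b₀)M(a₀)⁻¹`, `M(a₀)⁻¹M(b₀)`;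
* **the invariance principle, lower bound** (`andersonLyapunov_le_integral_of_stationary`):
  `L(E) ≤ ∫ g_1 dm` for EVERY stationary `m`, from the cone estimate
  `n ∫ g_1 dm = ∫ g_n dm ≥ 𝔼 log ‖M_n‖ + log(s/2) - 2n log(|E|+R+1)·η`;
* **uniform vector growth at one scale** (`exists_scale_uniform_vector_growth`): for every
  `ε > 0` some `n ≥ 1` has `𝔼 log ‖M_n^E v‖ ≥ n(L(E) - ε)` for ALL unit `v` — otherwise the Cesàro
  averages of the orbit laws of bad vectors have a weak limit point (compactness of
  `ProbabilityMeasure 𝕊¹`, Mathlib's Prokhorov file), which is stationary (Krylov–Bogolyubov,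
  `map_prod_eq_of_tendsto_of_approx`) with `∫ g_1 dm ≤ L - ε`, a contradiction.

The projective action `act` and the orbit maps `o` enter as explicit functions together with
their defining equations (no auxiliary definitions are introduced).  Not here: the continuity
theorem itself (`AndersonModel1DProofs.lean`).
-/

noncomputable section

open MeasureTheory Filter Set Topology
open scoped Matrix.Norms.L2Operator Matrix ENNReal BoundedContinuousFunction

namespace Literature.Probability.RandomMatrixProducts

section Stationary

/-! ### General-index continuity helpers on the circle -/

/-- `w ↦ g_k^E(w) = 𝔼 log ‖M_k^E w‖` is continuous on the unit circle. [folklore] -/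
theorem continuous_sphere_logNormAvg (μ : Measure ℝ) [IsProbabilityMeasure μ] {R : ℝ} (hR0 : 0 ≤ R)
    (hR : ∀ᵐ x ∂μ, |x| ≤ R) (E : ℝ) (k : ℕ) :
    Continuous fun w : (Metric.sphere (0 : EuclideanSpace ℝ (Fin 2)) 1) =>
      ∫ y, Real.log ‖Matrix.toEuclideanLin (andersonTransferProd E (padSeq y) k) (w : EuclideanSpace ℝ (Fin 2))‖
        ∂(Measure.pi fun _ : Fin k => μ) :=
  ((continuous_integral_log_norm_transferProd_apply μ hR0 hR k).comp (Continuous.prodMk_right E) :)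

/-- `(x, w) ↦ M_k^E(x) w` is continuous on `ℝ^k × 𝕊¹`. [folklore] -/
theorem continuous_prod_sphere_transferProd_apply (E : ℝ) (k : ℕ) :
    Continuous fun p : (Fin k → ℝ) × (Metric.sphere (0 : EuclideanSpace ℝ (Fin 2)) 1) =>
      Matrix.toEuclideanLin (andersonTransferProd E (padSeq p.1) k) ((p.2 : (Metric.sphere (0 : EuclideanSpace ℝ (Fin 2)) 1)) : EuclideanSpace ℝ (Fin 2)) :=
  ((continuous_andersonTransferProd_param_apply (n := k) k).comp
    (((continuous_const (y := E)).prodMk continuous_fst).prodMk (continuous_subtype_val.comp continuous_snd)) :)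

/-- `(x, w) ↦ log ‖M_k^E(x) w‖` is continuous on `ℝ^k × 𝕊¹` (the vector never vanishes). [folklore] -/
theorem continuous_prod_sphere_log_norm_apply (E : ℝ) (k : ℕ) :
    Continuous fun p : (Fin k → ℝ) × (Metric.sphere (0 : EuclideanSpace ℝ (Fin 2)) 1) =>
      Real.log ‖Matrix.toEuclideanLin (andersonTransferProd E (padSeq p.1) k) ((p.2 : (Metric.sphere (0 : EuclideanSpace ℝ (Fin 2)) 1)) : EuclideanSpace ℝ (Fin 2))‖ := by
  have hunit : ∀ w : (Metric.sphere (0 : EuclideanSpace ℝ (Fin 2)) 1), ‖(w : EuclideanSpace ℝ (Fin 2))‖ = 1 := fun w => by simp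
  refine Real.continuousOn_log.comp_continuous (continuous_prod_sphere_transferProd_apply E k).norm
    fun p => ?_
  exact (norm_pos_iff.mpr (toEuclideanLin_ne_zero_of_det _ (det_andersonTransferProd E _ k)
    (fun h0 => by have := hunit p.2; rw [h0, norm_zero] at this; exact zero_ne_one this))).ne'

/-- `w ↦ log ‖M_k^E(x) w‖` is continuous on the circle for a fixed sample. [folklore] -/
theorem continuous_sphere_log_norm_apply (E : ℝ) {k : ℕ} (x : Fin k → ℝ) :
    Continuous fun w : (Metric.sphere (0 : EuclideanSpace ℝ (Fin 2)) 1) =>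
      Real.log ‖Matrix.toEuclideanLin (andersonTransferProd E (padSeq x) k) ((w : (Metric.sphere (0 : EuclideanSpace ℝ (Fin 2)) 1)) : EuclideanSpace ℝ (Fin 2))‖ :=
  ((continuous_prod_sphere_log_norm_apply E k).comp (Continuous.prodMk_right x) :)

/-- Measurability of `log ‖M_k(f(p)) w‖` for a measurable reparametrisation `f` of the sample
(stated for a general index to keep definitional unfolding of the cocycle out of unification). [folklore] -/
theorem measurable_log_norm_transferProd_apply_comp (E : ℝ) {k : ℕ} {β : Type*} [MeasurableSpace β]
    {f : β → (Fin k → ℝ)} (hf : Measurable f) (w : EuclideanSpace ℝ (Fin 2)) :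
    Measurable fun p : β =>
      Real.log ‖Matrix.toEuclideanLin (andersonTransferProd E (padSeq (f p)) k) w‖ :=
  ((measurable_log_norm_transferProd_apply E k k w).comp hf :)


/-! ### Two-dimensional geometry: the wedge and the pair inequality -/

/-- Lagrange's identity in the plane: `(v·u)² + (v∧u)² = ‖v‖² ‖u‖²`. [folklore] -/
theorem inner_sq_add_wedge_sq (v u : EuclideanSpace ℝ (Fin 2)) :
    (v 0 * u 0 + v 1 * u 1) ^ 2 + (v 0 * u 1 - v 1 * u 0) ^ 2 = ‖v‖ ^ 2 * ‖u‖ ^ 2 := by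
  have hns : ∀ w : EuclideanSpace ℝ (Fin 2), ‖w‖ ^ 2 = w 0 ^ 2 + w 1 ^ 2 := fun w => by
    rw [EuclideanSpace.norm_sq_eq]; simp [Fin.sum_univ_two]
  rw [hns, hns]; ring

/-- `|v ∧ u| ≤ ‖v‖ ‖u‖`. [folklore] -/
theorem abs_wedge_le (v u : EuclideanSpace ℝ (Fin 2)) :
    |v 0 * u 1 - v 1 * u 0| ≤ ‖v‖ * ‖u‖ := by
  rw [← abs_of_nonneg (mul_nonneg (norm_nonneg v) (norm_nonneg u)), ← sq_le_sq, mul_pow,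
    ← inner_sq_add_wedge_sq]
  nlinarith [sq_nonneg (v 0 * u 0 + v 1 * u 1)]

/-- Two unit vectors with vanishing wedge are equal or opposite. [folklore] -/
theorem eq_or_eq_neg_of_wedge_eq_zero {v u : EuclideanSpace ℝ (Fin 2)} (hv : ‖v‖ = 1) (hu : ‖u‖ = 1)
    (h : v 0 * u 1 - v 1 * u 0 = 0) : v = u ∨ v = -u := by
  have hns : ∀ w : EuclideanSpace ℝ (Fin 2), ‖w‖ ^ 2 = w 0 ^ 2 + w 1 ^ 2 := fun w => by
    rw [EuclideanSpace.norm_sq_eq]; simp [Fin.sum_univ_two]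
  have hv2 : v 0 ^ 2 + v 1 ^ 2 = 1 := by rw [← hns, hv]; norm_num
  have hu2 : u 0 ^ 2 + u 1 ^ 2 = 1 := by rw [← hns, hu]; norm_num
  have hlag := inner_sq_add_wedge_sq v u
  rw [h, hv, hu] at hlag
  have hc : (v 0 * u 0 + v 1 * u 1) ^ 2 = 1 := by nlinarith [hlag]
  have hc' : v 0 * u 0 + v 1 * u 1 = 1 ∨ v 0 * u 0 + v 1 * u 1 = -1 := by
    rcases eq_or_ne (v 0 * u 0 + v 1 * u 1) 1 with h1 | h1
    · exact Or.inl h1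
    · right
      have : (v 0 * u 0 + v 1 * u 1 - 1) * (v 0 * u 0 + v 1 * u 1 + 1) = 0 := by nlinarith [hc]
      rcases mul_eq_zero.mp this with h2 | h2
      · exact absurd (by linarith) h1
      · linarith
  rcases hc' with hc1 | hc1
  · left
    have h0 : (v 0 - u 0) ^ 2 + (v 1 - u 1) ^ 2 = 0 := by nlinarith [hv2, hu2, hc1]
    have e0 : v 0 = u 0 := by nlinarith [sq_nonneg (v 0 - u 0), sq_nonneg (v 1 - u 1)]
    have e1 : v 1 = u 1 := by nlinarith [sq_nonneg (v 0 - u 0), sq_nonneg (v 1 - u 1)]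
    apply PiLp.ext; intro i; fin_cases i
    · exact e0
    · exact e1
  · right
    have h0 : (v 0 + u 0) ^ 2 + (v 1 + u 1) ^ 2 = 0 := by nlinarith [hv2, hu2, hc1]
    have e0 : v 0 = -u 0 := by nlinarith [sq_nonneg (v 0 + u 0), sq_nonneg (v 1 + u 1)]
    have e1 : v 1 = -u 1 := by nlinarith [sq_nonneg (v 0 + u 0), sq_nonneg (v 1 + u 1)]
    apply PiLp.ext; intro i; fin_cases i
    · simpa using e0
    · simpa using e1

/-- **The pair inequality**: for unit vectors `v, v'` and any `X`,
`|v ∧ v'| ‖X‖ ≤ ‖X v‖ + ‖X v'‖` (expand a unit `w` in the basis `v, v'` by Cramer's rule).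
[folklore] -/
theorem abs_wedge_mul_norm_le (X : Matrix (Fin 2) (Fin 2) ℝ) {v v' : EuclideanSpace ℝ (Fin 2)}
    (hv : ‖v‖ = 1) (hv' : ‖v'‖ = 1) :
    |v 0 * v' 1 - v 1 * v' 0| * ‖X‖ ≤
      ‖Matrix.toEuclideanLin X v‖ + ‖Matrix.toEuclideanLin X v'‖ := by
  set s := v 0 * v' 1 - v 1 * v' 0 with hs
  rcases eq_or_ne s 0 with hs0 | hs0
  · rw [hs0, abs_zero, zero_mul]; positivity
  have hspos : 0 < |s| := abs_pos.mpr hs0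
  rw [← le_div_iff₀' hspos, Matrix.l2_opNorm_def]
  refine ContinuousLinearMap.opNorm_le_bound _ (by positivity) fun w => ?_
  -- Cramer: w = ((w ∧ v')/s) v + ((v ∧ w)/s) v'
  have hdec : w = ((w 0 * v' 1 - w 1 * v' 0) / s) • v + ((v 0 * w 1 - v 1 * w 0) / s) • v' := by
    apply PiLp.ext; intro i
    fin_cases i
    · simp only [Fin.zero_eta, Fin.isValue, PiLp.add_apply, PiLp.smul_apply, smul_eq_mul]
      field_simp
      rw [hs]; ring
    · simp only [Fin.mk_one, Fin.isValue, PiLp.add_apply, PiLp.smul_apply, smul_eq_mul]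
      field_simp
      rw [hs]; ring
  have h1 : |w 0 * v' 1 - w 1 * v' 0| ≤ ‖w‖ := by simpa [hv'] using abs_wedge_le w v'
  have h2 : |v 0 * w 1 - v 1 * w 0| ≤ ‖w‖ := by
    have := abs_wedge_le v w; rw [hv, one_mul] at this; exact this
  show ‖Matrix.toEuclideanLin X w‖ ≤ _
  calc ‖Matrix.toEuclideanLin X w‖
      = ‖((w 0 * v' 1 - w 1 * v' 0) / s) • Matrix.toEuclideanLin X v +
          ((v 0 * w 1 - v 1 * w 0) / s) • Matrix.toEuclideanLin X v'‖ := by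
        conv_lhs => rw [hdec]
        rw [map_add, map_smul, map_smul]
    _ ≤ |(w 0 * v' 1 - w 1 * v' 0) / s| * ‖Matrix.toEuclideanLin X v‖ +
          |(v 0 * w 1 - v 1 * w 0) / s| * ‖Matrix.toEuclideanLin X v'‖ := by
        refine (norm_add_le _ _).trans ?_
        rw [norm_smul, norm_smul, Real.norm_eq_abs, Real.norm_eq_abs]
    _ ≤ ‖w‖ / |s| * ‖Matrix.toEuclideanLin X v‖ + ‖w‖ / |s| * ‖Matrix.toEuclideanLin X v'‖ := by
        rw [abs_div, abs_div]
        gcongr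
    _ = (‖Matrix.toEuclideanLin X v‖ + ‖Matrix.toEuclideanLin X v'‖) / |s| * ‖w‖ := by ring

/-- **The bad set of a matrix has small projective diameter**: if two unit vectors are both
contracted below `‖X‖ s / 2`, their wedge is `< s`. [folklore] -/
theorem abs_wedge_lt_of_norm_apply_lt (X : Matrix (Fin 2) (Fin 2) ℝ) (hX : 0 < ‖X‖)
    {v v' : EuclideanSpace ℝ (Fin 2)} (hv : ‖v‖ = 1) (hv' : ‖v'‖ = 1) {s : ℝ}
    (h1 : ‖Matrix.toEuclideanLin X v‖ < ‖X‖ * s / 2) (h2 : ‖Matrix.toEuclideanLin X v'‖ < ‖X‖ * s / 2) :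
    |v 0 * v' 1 - v 1 * v' 0| < s := by
  have h := abs_wedge_mul_norm_le X hv hv'
  by_contra hle
  rw [not_lt] at hle
  have : s * ‖X‖ ≤ |v 0 * v' 1 - v 1 * v' 0| * ‖X‖ := by gcongr
  linarith

/-! ### Normalisation to the unit circle -/

/-- `‖c w‖⁻¹ (c w) = ‖w‖⁻¹ w` for `c > 0`. [folklore] -/
theorem inv_norm_smul_smul {c : ℝ} (hc : 0 < c) (w : EuclideanSpace ℝ (Fin 2)) :
    ‖c • w‖⁻¹ • (c • w) = ‖w‖⁻¹ • w := by
  rw [norm_smul, Real.norm_eq_abs, abs_of_pos hc, smul_smul]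
  congr 1
  field_simp

/-- Normalising after a linear map forgets a prior normalisation:
`‖X(‖u‖⁻¹u)‖⁻¹ X(‖u‖⁻¹u) = ‖Xu‖⁻¹ Xu`. [folklore] -/
theorem inv_norm_smul_toEuclideanLin_unit (X : Matrix (Fin 2) (Fin 2) ℝ) {u : EuclideanSpace ℝ (Fin 2)}
    (hu : u ≠ 0) :
    ‖Matrix.toEuclideanLin X (‖u‖⁻¹ • u)‖⁻¹ • Matrix.toEuclideanLin X (‖u‖⁻¹ • u) =
      ‖Matrix.toEuclideanLin X u‖⁻¹ • Matrix.toEuclideanLin X u := by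
  rw [map_smul]
  exact inv_norm_smul_smul (inv_pos.mpr (norm_pos_iff.mpr hu)) _

/-! ### Non-atomic measures on the circle: uniform smallness of thin double cones -/

/-- For a finite measure on the unit circle without atoms, the mass of the double cone
`{v : |v ∧ u| < s}` around `±u` is small uniformly in `u` once `s` is small (compactness).
[folklore] -/
theorem exists_forall_measure_wedge_lt_le
    (m : Measure (Metric.sphere (0 : EuclideanSpace ℝ (Fin 2)) 1)) [IsFiniteMeasure m]
    (hm : ∀ x, m {x} = 0) {η : ℝ≥0∞} (hη : 0 < η) :
    ∃ s : ℝ, 0 < s ∧ ∀ u : (Metric.sphere (0 : EuclideanSpace ℝ (Fin 2)) 1),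
      m {v : (Metric.sphere (0 : EuclideanSpace ℝ (Fin 2)) 1) | |(v : EuclideanSpace ℝ (Fin 2)) 0 * (u : EuclideanSpace ℝ (Fin 2)) 1 - (v : EuclideanSpace ℝ (Fin 2)) 1 * (u : EuclideanSpace ℝ (Fin 2)) 0| < s} ≤ η := by
  -- the wedge as a continuous function of the pair
  have hco : ∀ i, Continuous fun v : (Metric.sphere (0 : EuclideanSpace ℝ (Fin 2)) 1) => (v : EuclideanSpace ℝ (Fin 2)) i :=
    fun i => (continuous_apply i).comp ((PiLp.continuous_ofLp 2 _).comp continuous_subtype_val)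
  have hmeas : ∀ (u : (Metric.sphere (0 : EuclideanSpace ℝ (Fin 2)) 1)) (t : ℝ), MeasurableSet
      {v : (Metric.sphere (0 : EuclideanSpace ℝ (Fin 2)) 1) | |(v : EuclideanSpace ℝ (Fin 2)) 0 * (u : EuclideanSpace ℝ (Fin 2)) 1 - (v : EuclideanSpace ℝ (Fin 2)) 1 * (u : EuclideanSpace ℝ (Fin 2)) 0| < t} := by
    intro u t
    have hc : Continuous fun v : (Metric.sphere (0 : EuclideanSpace ℝ (Fin 2)) 1) => |(v : EuclideanSpace ℝ (Fin 2)) 0 * (u : EuclideanSpace ℝ (Fin 2)) 1 - (v : EuclideanSpace ℝ (Fin 2)) 1 * (u : EuclideanSpace ℝ (Fin 2)) 0| :=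
      (((hco 0).mul continuous_const).sub ((hco 1).mul continuous_const)).abs
    exact measurableSet_lt hc.measurable measurable_const
  by_contra hcon
  push Not at hcon
  -- bad centres at scale 1/(k+1)
  have hk : ∀ k : ℕ, ∃ u : (Metric.sphere (0 : EuclideanSpace ℝ (Fin 2)) 1),
      η < m {v : (Metric.sphere (0 : EuclideanSpace ℝ (Fin 2)) 1) | |(v : EuclideanSpace ℝ (Fin 2)) 0 * (u : EuclideanSpace ℝ (Fin 2)) 1 - (v : EuclideanSpace ℝ (Fin 2)) 1 * (u : EuclideanSpace ℝ (Fin 2)) 0| < 1 / ((k : ℝ) + 1)} :=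
    fun k => hcon _ (by positivity)
  choose u hu using hk
  obtain ⟨u₀, φ, hφ, hlim⟩ := SeqCompactSpace.tendsto_subseq u
  -- every cone around u₀ has mass > η
  have hcone : ∀ t : ℝ, 0 < t →
      η < m {v : (Metric.sphere (0 : EuclideanSpace ℝ (Fin 2)) 1) | |(v : EuclideanSpace ℝ (Fin 2)) 0 * (u₀ : EuclideanSpace ℝ (Fin 2)) 1 - (v : EuclideanSpace ℝ (Fin 2)) 1 * (u₀ : EuclideanSpace ℝ (Fin 2)) 0| < t} := by
    intro t ht
    have hd : Tendsto (fun k => ‖((u (φ k) : (Metric.sphere (0 : EuclideanSpace ℝ (Fin 2)) 1)) : EuclideanSpace ℝ (Fin 2)) - (u₀ : EuclideanSpace ℝ (Fin 2))‖) atTop (𝓝 0) := by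
      have h1 : Tendsto (fun k => ((u (φ k) : (Metric.sphere (0 : EuclideanSpace ℝ (Fin 2)) 1)) : EuclideanSpace ℝ (Fin 2))) atTop (𝓝 (u₀ : EuclideanSpace ℝ (Fin 2))) :=
        (continuous_subtype_val.tendsto u₀).comp hlim
      exact tendsto_iff_norm_sub_tendsto_zero.mp h1
    have hr : Tendsto (fun k : ℕ => 1 / ((φ k : ℝ) + 1)) atTop (𝓝 0) :=
      tendsto_one_div_add_atTop_nhds_zero_nat.comp hφ.tendsto_atTop
    have hsum : Tendsto (fun k => 1 / ((φ k : ℝ) + 1) + ‖((u (φ k) : (Metric.sphere (0 : EuclideanSpace ℝ (Fin 2)) 1)) : EuclideanSpace ℝ (Fin 2)) - (u₀ : EuclideanSpace ℝ (Fin 2))‖)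
        atTop (𝓝 0) := by simpa using hr.add hd
    obtain ⟨k, hk⟩ := (hsum.eventually (gt_mem_nhds ht)).exists
    refine (hu (φ k)).trans_le (measure_mono fun v hv => ?_)
    simp only [Set.mem_setOf_eq] at hv ⊢
    have hw := abs_wedge_le (v : EuclideanSpace ℝ (Fin 2)) (((u (φ k) : (Metric.sphere (0 : EuclideanSpace ℝ (Fin 2)) 1)) : EuclideanSpace ℝ (Fin 2)) - (u₀ : EuclideanSpace ℝ (Fin 2)))
    have hv1 : ‖(v : EuclideanSpace ℝ (Fin 2))‖ = 1 := by simp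
    rw [hv1, one_mul] at hw
    have e : (v : EuclideanSpace ℝ (Fin 2)) 0 * (u₀ : EuclideanSpace ℝ (Fin 2)) 1 - (v : EuclideanSpace ℝ (Fin 2)) 1 * (u₀ : EuclideanSpace ℝ (Fin 2)) 0 =
        ((v : EuclideanSpace ℝ (Fin 2)) 0 * ((u (φ k) : (Metric.sphere (0 : EuclideanSpace ℝ (Fin 2)) 1)) : EuclideanSpace ℝ (Fin 2)) 1 - (v : EuclideanSpace ℝ (Fin 2)) 1 * ((u (φ k) : (Metric.sphere (0 : EuclideanSpace ℝ (Fin 2)) 1)) : EuclideanSpace ℝ (Fin 2)) 0) -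
        ((v : EuclideanSpace ℝ (Fin 2)) 0 * (((u (φ k) : (Metric.sphere (0 : EuclideanSpace ℝ (Fin 2)) 1)) : EuclideanSpace ℝ (Fin 2)) - (u₀ : EuclideanSpace ℝ (Fin 2))) 1 -
          (v : EuclideanSpace ℝ (Fin 2)) 1 * (((u (φ k) : (Metric.sphere (0 : EuclideanSpace ℝ (Fin 2)) 1)) : EuclideanSpace ℝ (Fin 2)) - (u₀ : EuclideanSpace ℝ (Fin 2))) 0) := by
      simp only [PiLp.sub_apply]; ring
    rw [e]
    have htri := abs_sub ((v : EuclideanSpace ℝ (Fin 2)) 0 * ((u (φ k) : (Metric.sphere (0 : EuclideanSpace ℝ (Fin 2)) 1)) : EuclideanSpace ℝ (Fin 2)) 1 - (v : EuclideanSpace ℝ (Fin 2)) 1 * ((u (φ k) : (Metric.sphere (0 : EuclideanSpace ℝ (Fin 2)) 1)) : EuclideanSpace ℝ (Fin 2)) 0)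
      ((v : EuclideanSpace ℝ (Fin 2)) 0 * (((u (φ k) : (Metric.sphere (0 : EuclideanSpace ℝ (Fin 2)) 1)) : EuclideanSpace ℝ (Fin 2)) - (u₀ : EuclideanSpace ℝ (Fin 2))) 1 - (v : EuclideanSpace ℝ (Fin 2)) 1 * (((u (φ k) : (Metric.sphere (0 : EuclideanSpace ℝ (Fin 2)) 1)) : EuclideanSpace ℝ (Fin 2)) - (u₀ : EuclideanSpace ℝ (Fin 2))) 0)
    linarith
  -- continuity from above along the cones of width 1/(j+1)
  set A : ℕ → Set (Metric.sphere (0 : EuclideanSpace ℝ (Fin 2)) 1) := fun j =>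
    {v : (Metric.sphere (0 : EuclideanSpace ℝ (Fin 2)) 1) | |(v : EuclideanSpace ℝ (Fin 2)) 0 * (u₀ : EuclideanSpace ℝ (Fin 2)) 1 - (v : EuclideanSpace ℝ (Fin 2)) 1 * (u₀ : EuclideanSpace ℝ (Fin 2)) 0| < 1 / ((j : ℝ) + 1)} with hA
  have hAanti : Antitone A := by
    intro i j hij v hv
    simp only [hA, Set.mem_setOf_eq] at hv ⊢
    have : 1 / ((j : ℝ) + 1) ≤ 1 / ((i : ℝ) + 1) := by
      apply one_div_le_one_div_of_le (by positivity)
      exact_mod_cast Nat.succ_le_succ hij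
    exact hv.trans_le this
  have hlimA : Tendsto (fun j => m (A j)) atTop (𝓝 (m (⋂ j, A j))) :=
    tendsto_measure_iInter_atTop (fun j => (hmeas u₀ _).nullMeasurableSet) hAanti
      ⟨0, measure_ne_top m _⟩
  have hge : η ≤ m (⋂ j, A j) :=
    ge_of_tendsto' hlimA fun j => (hcone _ (by positivity)).le
  -- but the intersection is {u₀, -u₀}
  have hu₀1 : ‖(u₀ : EuclideanSpace ℝ (Fin 2))‖ = 1 := by simp
  let nu₀ : (Metric.sphere (0 : EuclideanSpace ℝ (Fin 2)) 1) := ⟨-(u₀ : EuclideanSpace ℝ (Fin 2)), by simp⟩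
  have hsub : (⋂ j, A j) ⊆ {u₀, nu₀} := by
    intro v hv
    simp only [Set.mem_iInter, hA, Set.mem_setOf_eq] at hv
    have h0 : (v : EuclideanSpace ℝ (Fin 2)) 0 * (u₀ : EuclideanSpace ℝ (Fin 2)) 1 - (v : EuclideanSpace ℝ (Fin 2)) 1 * (u₀ : EuclideanSpace ℝ (Fin 2)) 0 = 0 := by
      by_contra hne
      have hpos : 0 < |(v : EuclideanSpace ℝ (Fin 2)) 0 * (u₀ : EuclideanSpace ℝ (Fin 2)) 1 - (v : EuclideanSpace ℝ (Fin 2)) 1 * (u₀ : EuclideanSpace ℝ (Fin 2)) 0| := abs_pos.mpr hne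
      obtain ⟨j, hj⟩ := exists_nat_one_div_lt hpos
      exact absurd (hv j) (not_lt.mpr hj.le)
    have hv1 : ‖(v : EuclideanSpace ℝ (Fin 2))‖ = 1 := by simp
    rcases eq_or_eq_neg_of_wedge_eq_zero hv1 hu₀1 h0 with h | h
    · left; exact Subtype.ext h
    · right; exact Subtype.ext h
  have hzero : m (⋂ j, A j) = 0 := by
    refine le_antisymm ((measure_mono hsub).trans ?_) bot_le
    rw [Set.insert_eq]
    refine (measure_union_le _ _).trans ?_
    rw [hm u₀, hm nu₀, add_zero]
  rw [hzero] at hge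
  exact absurd hge (not_le.mpr hη)

/-! ### Splitting off the last site; the single-site law as `μ^{⊗1}` -/

/-- **Integrating out the last site**: `∫ F dμ^{⊗(n+1)} = ∫ F(x :+ a) d(μ ⊗ μ^{⊗n})(a, x)`. [folklore] -/
theorem integral_pi_succ_eq_integral_prod_snoc (μ : Measure ℝ) [SigmaFinite μ] (n : ℕ)
    (F : (Fin (n + 1) → ℝ) → ℝ) :
    ∫ z, F z ∂(Measure.pi fun _ : Fin (n + 1) => μ) =
      ∫ p, F (Fin.snoc p.2 p.1) ∂(μ.prod (Measure.pi fun _ : Fin n => μ)) := by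
  have hmp := (measurePreserving_piFinSuccAbove (fun _ : Fin (n + 1) => μ) (Fin.last n)).symm
  rw [← hmp.integral_comp']
  refine integral_congr_ae (Eventually.of_forall fun p => ?_)
  change F (Fin.insertNth (Fin.last n) p.1 p.2) = F (Fin.snoc p.2 p.1)
  rw [Fin.insertNth_last']

/-- The snoc map `(a, x) ↦ x :+ a` is measurable. [folklore] -/
theorem measurable_snoc (n : ℕ) :
    Measurable fun p : ℝ × (Fin n → ℝ) => (Fin.snoc p.2 p.1 : Fin (n + 1) → ℝ) := by
  have : (fun p : ℝ × (Fin n → ℝ) => (Fin.snoc p.2 p.1 : Fin (n + 1) → ℝ)) =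
      fun p => (MeasurableEquiv.piFinSuccAbove (fun _ : Fin (n + 1) => ℝ) (Fin.last n)).symm p := by
    funext p
    change _ = (Fin.insertNth (Fin.last n) p.1 p.2 : Fin (n + 1) → ℝ)
    rw [Fin.insertNth_last']
  rw [this]
  exact (MeasurableEquiv.piFinSuccAbove (fun _ : Fin (n + 1) => ℝ) (Fin.last n)).symm.measurable

/-- The cons map `(a, x) ↦ a :: x` is measurable. [folklore] -/
theorem measurable_cons (n : ℕ) :
    Measurable fun p : ℝ × (Fin n → ℝ) => (Fin.cons p.1 p.2 : Fin (n + 1) → ℝ) := by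
  have : (fun p : ℝ × (Fin n → ℝ) => (Fin.cons p.1 p.2 : Fin (n + 1) → ℝ)) =
      fun p => (MeasurableEquiv.piFinSuccAbove (fun _ : Fin (n + 1) => ℝ) 0).symm p := by
    funext p
    change _ = (Fin.insertNth 0 p.1 p.2 : Fin (n + 1) → ℝ)
    rw [Fin.insertNth_zero']
  rw [this]
  exact (MeasurableEquiv.piFinSuccAbove (fun _ : Fin (n + 1) => ℝ) 0).symm.measurable

/-- **Cocycle over a sample with one site appended**: `M_{n+1}(x :+ a) = M^E(a) M_n(x)`.
[cite: BucajEtAl2019, §2 (display after eq. (2.1))] -/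
theorem andersonTransferProd_snoc (E a : ℝ) {n : ℕ} (x : Fin n → ℝ) :
    andersonTransferProd E (padSeq (Fin.snoc x a : Fin (n + 1) → ℝ)) (n + 1) =
      andersonTransfer E a * andersonTransferProd E (padSeq x) n := by
  rw [andersonTransferProd_succ, padSeq_of_lt _ (Nat.lt_succ_self n)]
  congr 1
  · change andersonTransfer E ((Fin.snoc x a : Fin (n + 1) → ℝ) (Fin.last n)) = _
    rw [Fin.snoc_last]
  · apply andersonTransferProd_congr
    intro k hk
    rw [padSeq_of_lt _ (by omega : k < n + 1), padSeq_of_lt _ hk]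
    have : (⟨k, (by omega : k < n + 1)⟩ : Fin (n + 1)) = Fin.castSucc ⟨k, hk⟩ := rfl
    rw [this, Fin.snoc_castSucc]

/-- The box for an appended site. [folklore] -/
theorem abs_snoc_le {n : ℕ} {a : ℝ} {x : Fin n → ℝ} {R : ℝ} (ha : |a| ≤ R) (hx : ∀ j, |x j| ≤ R) :
    ∀ i, |(Fin.snoc x a : Fin (n + 1) → ℝ) i| ≤ R := by
  intro i
  refine Fin.lastCases ?_ (fun j => ?_) i
  · simpa using ha
  · simpa using hx j

/-- `M_1(x) = M^E(x_0)`. [cite: BucajEtAl2019, §2 (display after eq. (2.1))] -/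
theorem andersonTransferProd_one (E : ℝ) (s : ℕ → ℝ) :
    andersonTransferProd E s 1 = andersonTransfer E (s 0) := by
  rw [andersonTransferProd_succ, andersonTransferProd_zero, mul_one]

/-- The single-site law as the one-fold product: `∫ F(x_0) dμ^{⊗1}(x) = ∫ F dμ`. [folklore] -/
theorem integral_pi_one_eq (μ : Measure ℝ) [SigmaFinite μ] (F : ℝ → ℝ) :
    ∫ y, F (y 0) ∂(Measure.pi fun _ : Fin 1 => μ) = ∫ a, F a ∂μ := by
  rw [← (measurePreserving_funUnique μ (Fin 1)).integral_comp']
  refine integral_congr_ae (Eventually.of_forall fun y => ?_)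
  rw [MeasurableEquiv.funUnique_apply]
  exact congrArg F (congrArg y (Subsingleton.elim _ _))

/-- `𝔼 log ‖M^E(a) w‖ = g_1^E(w)` (the single site as a one-fold product).
[cite: BucajEtAl2019, §2 (definition of `L`)] -/
theorem integral_log_norm_transfer_apply_eq_pi_one (μ : Measure ℝ) [SigmaFinite μ] (E : ℝ)
    (w : EuclideanSpace ℝ (Fin 2)) :
    ∫ a, Real.log ‖Matrix.toEuclideanLin (andersonTransfer E a) w‖ ∂μ =
      ∫ y, Real.log ‖Matrix.toEuclideanLin (andersonTransferProd E (padSeq y) 1) w‖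
        ∂(Measure.pi fun _ : Fin 1 => μ) := by
  rw [← integral_pi_one_eq μ (fun a => Real.log ‖Matrix.toEuclideanLin (andersonTransfer E a) w‖)]
  refine integral_congr_ae (Eventually.of_forall fun y => ?_)
  simp only [andersonTransferProd_one, padSeq_of_lt _ Nat.one_pos]
  rfl

/-! ### The orbit measures and the one-step identities -/

/-- **Orbit identity for the one-step average**: if `o(x) = M_j(x)v/‖M_j(x)v‖` (unit `v`) then
`∫ g_1 d(o_* μ^{⊗j}) = g_{j+1}(v) - g_j(v)` (`g_n(u) = 𝔼 log ‖M_n u‖`), by homogeneity and the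
cocycle property over an appended site. [cite: BucajEtAl2019, §2–3 (cocycle property)] -/
theorem integral_orbit_logNormOne (μ : Measure ℝ) [IsProbabilityMeasure μ] {R : ℝ} (hR0 : 0 ≤ R)
    (hR : ∀ᵐ x ∂μ, |x| ≤ R) (E : ℝ) {v : EuclideanSpace ℝ (Fin 2)} (hv : ‖v‖ = 1) (j : ℕ)
    (o : (Fin j → ℝ) → (Metric.sphere (0 : EuclideanSpace ℝ (Fin 2)) 1))
    (ho : ∀ x, (o x : EuclideanSpace ℝ (Fin 2)) = ‖Matrix.toEuclideanLin (andersonTransferProd E (padSeq x) j) v‖⁻¹ •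
      Matrix.toEuclideanLin (andersonTransferProd E (padSeq x) j) v)
    (hom : Measurable o) :
    ∫ w, (∫ y, Real.log ‖Matrix.toEuclideanLin (andersonTransferProd E (padSeq y) 1) (w : EuclideanSpace ℝ (Fin 2))‖
        ∂(Measure.pi fun _ : Fin 1 => μ)) ∂(Measure.map o (Measure.pi fun _ : Fin j => μ)) =
      (∫ z, Real.log ‖Matrix.toEuclideanLin (andersonTransferProd E (padSeq z) (j + 1)) v‖
          ∂(Measure.pi fun _ : Fin (j + 1) => μ)) -
        ∫ x, Real.log ‖Matrix.toEuclideanLin (andersonTransferProd E (padSeq x) j) v‖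
          ∂(Measure.pi fun _ : Fin j => μ) := by
  have hv0 : v ≠ 0 := by
    intro h; rw [h, norm_zero] at hv; exact zero_ne_one hv
  have hg1c : Continuous fun w : (Metric.sphere (0 : EuclideanSpace ℝ (Fin 2)) 1) =>
      ∫ y, Real.log ‖Matrix.toEuclideanLin (andersonTransferProd E (padSeq y) 1) (w : EuclideanSpace ℝ (Fin 2))‖
        ∂(Measure.pi fun _ : Fin 1 => μ) :=
    continuous_sphere_logNormAvg μ hR0 hR E 1
  rw [integral_map hom.aemeasurable hg1c.aestronglyMeasurable]
  -- pointwise: g_1(o x) = (∫∫ log ‖M_1(y) M_j(x) v‖) - log ‖M_j(x) v‖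
  have hpt : ∀ x : Fin j → ℝ,
      (∫ y, Real.log ‖Matrix.toEuclideanLin (andersonTransferProd E (padSeq y) 1) ((o x : (Metric.sphere (0 : EuclideanSpace ℝ (Fin 2)) 1)) : EuclideanSpace ℝ (Fin 2))‖
        ∂(Measure.pi fun _ : Fin 1 => μ)) =
      (∫ y, Real.log ‖Matrix.toEuclideanLin (andersonTransferProd E (padSeq y) 1)
          (Matrix.toEuclideanLin (andersonTransferProd E (padSeq x) j) v)‖
        ∂(Measure.pi fun _ : Fin 1 => μ)) -
        Real.log ‖Matrix.toEuclideanLin (andersonTransferProd E (padSeq x) j) v‖ := by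
    intro x
    have hu0 : Matrix.toEuclideanLin (andersonTransferProd E (padSeq x) j) v ≠ 0 :=
      toEuclideanLin_ne_zero_of_det _ (det_andersonTransferProd E _ j) hv0
    rw [ho x, integral_log_norm_transferProd_apply_eq_add_unit μ hR0 hR E 1 hu0]
    ring
  simp_rw [hpt]
  -- the double integral is g_{j+1}(v)
  have hsplit : ∀ w : (Fin j → ℝ) × (Fin 1 → ℝ),
      Real.log ‖Matrix.toEuclideanLin (andersonTransferProd E (padSeq (Fin.append w.1 w.2)) (j + 1)) v‖ =
        Real.log ‖Matrix.toEuclideanLin (andersonTransferProd E (padSeq w.2) 1)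
          (Matrix.toEuclideanLin (andersonTransferProd E (padSeq w.1) j) v)‖ := by
    intro w
    rw [andersonTransferProd_append E w.1 w.2, toEuclideanLin_mul_apply]
  have hmeas : Measurable fun w : (Fin j → ℝ) × (Fin 1 → ℝ) =>
      Real.log ‖Matrix.toEuclideanLin (andersonTransferProd E (padSeq w.2) 1)
        (Matrix.toEuclideanLin (andersonTransferProd E (padSeq w.1) j) v)‖ := by
    have : (fun w : (Fin j → ℝ) × (Fin 1 → ℝ) =>
        Real.log ‖Matrix.toEuclideanLin (andersonTransferProd E (padSeq w.2) 1)
          (Matrix.toEuclideanLin (andersonTransferProd E (padSeq w.1) j) v)‖) =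
        fun w => Real.log ‖Matrix.toEuclideanLin
          (andersonTransferProd E (padSeq (Fin.append w.1 w.2)) (j + 1)) v‖ :=
      funext fun w => (hsplit w).symm
    rw [this]
    exact measurable_log_norm_transferProd_apply_comp E (measurable_finAppend j 1) v
  have hI : Integrable (fun w : (Fin j → ℝ) × (Fin 1 → ℝ) =>
      Real.log ‖Matrix.toEuclideanLin (andersonTransferProd E (padSeq w.2) 1)
        (Matrix.toEuclideanLin (andersonTransferProd E (padSeq w.1) j) v)‖)
      ((Measure.pi fun _ : Fin j => μ).prod (Measure.pi fun _ : Fin 1 => μ)) := by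
    refine Integrable.of_bound hmeas.aestronglyMeasurable ((j + 1 : ℕ) * Real.log (|E| + R + 1)) ?_
    filter_upwards [ae_prod_pi_abs_le hR j 1] with w hw
    rw [Real.norm_eq_abs, ← hsplit w]
    exact abs_log_norm_transferProd_apply_le hR0 (abs_append_le hw.1 hw.2) E hv
  rw [integral_sub hI.integral_prod_left (integrable_log_norm_transferProd_apply μ hR0 hR E j hv0),
    ← integral_prod _ hI,
    integral_pi_fin_add_eq_integral_prod μ j 1 (measurable_log_norm_transferProd_apply E (j + 1) (j + 1) v)]
  simp_rw [hsplit]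

/-- **Orbit identity for the transition operator**: with `o_j(x) = M_j(x)v/‖M_j(x)v‖` and the
projective action `act(a, w) = M(a)w/‖M(a)w‖`, for every bounded measurable `h` on the circle
`∫ (∫ h(act(a,w)) dμ(a)) d(o_{j*} μ^{⊗j})(w) = ∫ h d(o_{j+1 *} μ^{⊗(j+1)})` — the laws of the
directions form a Markov chain. [cite: BucajEtAl2019, §2 (the induced measure `ν_E = M^E_* μ̃` acting on `ℝℙ¹`)] -/
theorem integral_orbit_transition (μ : Measure ℝ) [IsProbabilityMeasure μ] (E : ℝ) {v : EuclideanSpace ℝ (Fin 2)}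
    (hv : ‖v‖ = 1) (j : ℕ)
    (act : ℝ × (Metric.sphere (0 : EuclideanSpace ℝ (Fin 2)) 1) → (Metric.sphere (0 : EuclideanSpace ℝ (Fin 2)) 1))
    (hact : ∀ a (w : (Metric.sphere (0 : EuclideanSpace ℝ (Fin 2)) 1)), (act (a, w) : EuclideanSpace ℝ (Fin 2)) =
      ‖Matrix.toEuclideanLin (andersonTransfer E a) (w : EuclideanSpace ℝ (Fin 2))‖⁻¹ •
        Matrix.toEuclideanLin (andersonTransfer E a) (w : EuclideanSpace ℝ (Fin 2)))
    (hactm : Measurable act)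
    (o : (Fin j → ℝ) → (Metric.sphere (0 : EuclideanSpace ℝ (Fin 2)) 1))
    (ho : ∀ x, (o x : EuclideanSpace ℝ (Fin 2)) = ‖Matrix.toEuclideanLin (andersonTransferProd E (padSeq x) j) v‖⁻¹ •
      Matrix.toEuclideanLin (andersonTransferProd E (padSeq x) j) v)
    (hom : Measurable o)
    (o' : (Fin (j + 1) → ℝ) → (Metric.sphere (0 : EuclideanSpace ℝ (Fin 2)) 1))
    (ho' : ∀ z, (o' z : EuclideanSpace ℝ (Fin 2)) = ‖Matrix.toEuclideanLin (andersonTransferProd E (padSeq z) (j + 1)) v‖⁻¹ •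
      Matrix.toEuclideanLin (andersonTransferProd E (padSeq z) (j + 1)) v)
    (ho'm : Measurable o')
    (h : (Metric.sphere (0 : EuclideanSpace ℝ (Fin 2)) 1) → ℝ) (hhm : Measurable h) {C : ℝ} (hhb : ∀ w, |h w| ≤ C) :
    ∫ w, (∫ a, h (act (a, w)) ∂μ) ∂(Measure.map o (Measure.pi fun _ : Fin j => μ)) =
      ∫ w, h w ∂(Measure.map o' (Measure.pi fun _ : Fin (j + 1) => μ)) := by
  have hv0 : v ≠ 0 := by
    intro h; rw [h, norm_zero] at hv; exact zero_ne_one hv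
  -- measurability of the transition integrand
  have hjm : Measurable fun p : ℝ × (Metric.sphere (0 : EuclideanSpace ℝ (Fin 2)) 1) => h (act p) := hhm.comp hactm
  have hPh : StronglyMeasurable fun w : (Metric.sphere (0 : EuclideanSpace ℝ (Fin 2)) 1) => ∫ a, h (act (a, w)) ∂μ :=
    hjm.stronglyMeasurable.integral_prod_left'
  rw [integral_map hom.aemeasurable hPh.aestronglyMeasurable,
    integral_map ho'm.aemeasurable hhm.aestronglyMeasurable]
  -- the key pointwise identity: act(a, o x) = o' (x :+ a)
  have hkey : ∀ (a : ℝ) (x : Fin j → ℝ), act (a, o x) = o' (Fin.snoc x a) := by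
    intro a x
    apply Subtype.ext
    rw [hact, ho x, ho', andersonTransferProd_snoc, toEuclideanLin_mul_apply]
    exact inv_norm_smul_toEuclideanLin_unit _
      (toEuclideanLin_ne_zero_of_det _ (det_andersonTransferProd E _ j) hv0)
  simp_rw [hkey]
  -- integrate: ∫_{P_j} ∫_μ H(x :+ a) = ∫_{P_{j+1}} H
  have hI : Integrable (fun p : ℝ × (Fin j → ℝ) => h (o' (Fin.snoc p.2 p.1)))
      (μ.prod (Measure.pi fun _ : Fin j => μ)) := by
    refine Integrable.of_bound ((hhm.comp (ho'm.comp (measurable_snoc j))).aestronglyMeasurable) C ?_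
    exact Eventually.of_forall fun p => by rw [Real.norm_eq_abs]; exact hhb _
  rw [integral_pi_succ_eq_integral_prod_snoc μ j, integral_prod_symm _ hI]

/-! ### Stationary measures: the invariance identity `∫ g_n dm = n ∫ g_1 dm` -/

/-- `M_0 = 𝕀` acts as the identity. [folklore] -/
theorem toEuclideanLin_transferProd_zero (E : ℝ) (s : ℕ → ℝ) (w : EuclideanSpace ℝ (Fin 2)) :
    Matrix.toEuclideanLin (andersonTransferProd E s 0) w = w := by
  rw [andersonTransferProd_zero]
  apply PiLp.ext
  intro i
  rw [toEuclideanLin_apply_two]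
  fin_cases i <;> simp [Matrix.one_apply]

/-- **One-site decomposition of the vector average** (Markov property + homogeneity): for a unit
vector `w`, `g_{n+1}(w) = ∫ (log ‖M(a)w‖ + g_n(M(a)w/‖M(a)w‖)) dμ(a)`.
[cite: BucajEtAl2019, §2–3 (cocycle property)] -/
theorem integral_logNorm_succ_eq_integral_site (μ : Measure ℝ) [IsProbabilityMeasure μ] {R : ℝ}
    (hR0 : 0 ≤ R) (hR : ∀ᵐ x ∂μ, |x| ≤ R) (E : ℝ) (n : ℕ) {w : EuclideanSpace ℝ (Fin 2)} (hw : ‖w‖ = 1) :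
    (∫ z, Real.log ‖Matrix.toEuclideanLin (andersonTransferProd E (padSeq z) (n + 1)) w‖
        ∂(Measure.pi fun _ : Fin (n + 1) => μ)) =
      ∫ a, (Real.log ‖Matrix.toEuclideanLin (andersonTransfer E a) w‖ +
        ∫ x, Real.log ‖Matrix.toEuclideanLin (andersonTransferProd E (padSeq x) n)
          (‖Matrix.toEuclideanLin (andersonTransfer E a) w‖⁻¹ • Matrix.toEuclideanLin (andersonTransfer E a) w)‖
          ∂(Measure.pi fun _ : Fin n => μ)) ∂μ := by
  have hw0 : w ≠ 0 := by
    intro h; rw [h, norm_zero] at hw; exact zero_ne_one hw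
  rw [integral_pi_succ_eq_integral_prod_cons μ n]
  have hsplit : ∀ p : ℝ × (Fin n → ℝ),
      Real.log ‖Matrix.toEuclideanLin (andersonTransferProd E (padSeq (Fin.cons p.1 p.2 : Fin (n + 1) → ℝ)) (n + 1)) w‖ =
        Real.log ‖Matrix.toEuclideanLin (andersonTransferProd E (padSeq p.2) n)
          (Matrix.toEuclideanLin (andersonTransfer E p.1) w)‖ := by
    intro p
    rw [andersonTransferProd_cons, toEuclideanLin_mul_apply]
  simp_rw [hsplit]
  have hmeas : Measurable fun p : ℝ × (Fin n → ℝ) =>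
      Real.log ‖Matrix.toEuclideanLin (andersonTransferProd E (padSeq p.2) n)
        (Matrix.toEuclideanLin (andersonTransfer E p.1) w)‖ := by
    have : (fun p : ℝ × (Fin n → ℝ) =>
        Real.log ‖Matrix.toEuclideanLin (andersonTransferProd E (padSeq p.2) n)
          (Matrix.toEuclideanLin (andersonTransfer E p.1) w)‖) =
        fun p => Real.log ‖Matrix.toEuclideanLin
          (andersonTransferProd E (padSeq (Fin.cons p.1 p.2 : Fin (n + 1) → ℝ)) (n + 1)) w‖ :=
      funext fun p => (hsplit p).symm
    rw [this]
    exact measurable_log_norm_transferProd_apply_comp E (measurable_cons n) _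
  have hI : Integrable (fun p : ℝ × (Fin n → ℝ) =>
      Real.log ‖Matrix.toEuclideanLin (andersonTransferProd E (padSeq p.2) n)
        (Matrix.toEuclideanLin (andersonTransfer E p.1) w)‖)
      (μ.prod (Measure.pi fun _ : Fin n => μ)) := by
    refine Integrable.of_bound hmeas.aestronglyMeasurable ((n + 1 : ℕ) * Real.log (|E| + R + 1)) ?_
    filter_upwards [ae_prod_cons_abs_le hR n] with p hp
    rw [Real.norm_eq_abs, ← hsplit p]
    exact abs_log_norm_transferProd_apply_le hR0 (abs_cons_le hp.1 hp.2) E hw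
  rw [integral_prod _ hI]
  refine integral_congr_ae (Eventually.of_forall fun a => ?_)
  have hu0 : Matrix.toEuclideanLin (andersonTransfer E a) w ≠ 0 :=
    toEuclideanLin_ne_zero_of_det _ (det_andersonTransfer E a) hw0
  have key := integral_log_norm_transferProd_apply_eq_add_unit μ hR0 hR E n hu0
  beta_reduce
  exact key

/-- `|log ‖M^E(a) w‖| ≤ log(|E|+R+1)` for `|a| ≤ R` and a unit vector `w`. [folklore] -/
theorem abs_log_norm_transfer_apply_le {E a R : ℝ} (hR0 : 0 ≤ R) (ha : |a| ≤ R) {w : EuclideanSpace ℝ (Fin 2)} (hw : ‖w‖ = 1) :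
    |Real.log ‖Matrix.toEuclideanLin (andersonTransfer E a) w‖| ≤ Real.log (|E| + R + 1) := by
  have hw0 : w ≠ 0 := by
    intro h; rw [h, norm_zero] at hw; exact zero_ne_one hw
  have h1 := norm_andersonTransfer_apply_le E a w
  have h2 := norm_le_norm_andersonTransfer_apply E a w
  rw [hw, mul_one] at h1
  rw [hw] at h2
  have hD : |E - a| + 1 ≤ |E| + R + 1 := by
    have := abs_sub E a; linarith
  have hpos : 0 < ‖Matrix.toEuclideanLin (andersonTransfer E a) w‖ :=
    norm_pos_iff.mpr (toEuclideanLin_ne_zero_of_det _ (det_andersonTransfer E a) hw0)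
  have hD0 : 0 < |E - a| + 1 := by positivity
  rw [abs_le]
  constructor
  · have hlow : (|E| + R + 1)⁻¹ ≤ ‖Matrix.toEuclideanLin (andersonTransfer E a) w‖ := by
      rw [inv_le_iff_one_le_mul₀' (by positivity)]
      calc (1 : ℝ) ≤ (|E - a| + 1) * ‖Matrix.toEuclideanLin (andersonTransfer E a) w‖ := h2
        _ ≤ (|E| + R + 1) * ‖Matrix.toEuclideanLin (andersonTransfer E a) w‖ := by gcongr
    have := Real.log_le_log (by positivity) hlow
    rwa [Real.log_inv] at this
  · exact (Real.log_le_log hpos h1).trans (Real.log_le_log hD0 hD)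

/-- `(a, w) ↦ M^E(a) w` is continuous on `ℝ × 𝕊¹`. [folklore] -/
theorem continuous_transfer_apply_sphere (E : ℝ) :
    Continuous fun p : ℝ × (Metric.sphere (0 : EuclideanSpace ℝ (Fin 2)) 1) => Matrix.toEuclideanLin (andersonTransfer E p.1) ((p.2 : (Metric.sphere (0 : EuclideanSpace ℝ (Fin 2)) 1)) : EuclideanSpace ℝ (Fin 2)) := by
  show Continuous fun p : ℝ × (Metric.sphere (0 : EuclideanSpace ℝ (Fin 2)) 1) => WithLp.toLp 2 ((andersonTransfer E p.1) *ᵥ ((p.2 : (Metric.sphere (0 : EuclideanSpace ℝ (Fin 2)) 1)) : EuclideanSpace ℝ (Fin 2)).ofLp)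
  refine (PiLp.continuous_toLp 2 _).comp ?_
  refine continuous_pi fun i => ?_
  simp only [Matrix.mulVec, dotProduct, Fin.sum_univ_two]
  have h2 : ∀ j, Continuous fun p : ℝ × (Metric.sphere (0 : EuclideanSpace ℝ (Fin 2)) 1) => ((p.2 : (Metric.sphere (0 : EuclideanSpace ℝ (Fin 2)) 1)) : EuclideanSpace ℝ (Fin 2)).ofLp j :=
    fun j => (continuous_apply j).comp ((PiLp.continuous_ofLp 2 _).comp
      (continuous_subtype_val.comp continuous_snd))
  fin_cases i <;> simp [andersonTransfer] <;> fun_prop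

/-- **Invariance identity**: for a probability measure `m` on the circle that is stationary under
the projective action of `M^E(a)`, `a ∼ μ` (`(act)_*(μ ⊗ m) = m`), the averaged vector growth is
additive: `∫ g_n dm = n ∫ g_1 dm` (`g_n(w) = 𝔼 log ‖M_n w‖`) — Fürstenberg's formula in finite
volume. [cite: BucajEtAl2019, Thm 2.5 (Fürstenberg–Kifer; the cocycle average against a stationary measure)] -/
theorem integral_logNorm_eq_mul_of_stationary (μ : Measure ℝ) [IsProbabilityMeasure μ] {R : ℝ}
    (hR0 : 0 ≤ R) (hR : ∀ᵐ x ∂μ, |x| ≤ R) (E : ℝ)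
    (act : ℝ × (Metric.sphere (0 : EuclideanSpace ℝ (Fin 2)) 1) → (Metric.sphere (0 : EuclideanSpace ℝ (Fin 2)) 1))
    (hact : ∀ a (w : (Metric.sphere (0 : EuclideanSpace ℝ (Fin 2)) 1)), (act (a, w) : EuclideanSpace ℝ (Fin 2)) =
      ‖Matrix.toEuclideanLin (andersonTransfer E a) (w : EuclideanSpace ℝ (Fin 2))‖⁻¹ •
        Matrix.toEuclideanLin (andersonTransfer E a) (w : EuclideanSpace ℝ (Fin 2)))
    (hactm : Measurable act)
    (m : Measure (Metric.sphere (0 : EuclideanSpace ℝ (Fin 2)) 1)) [IsProbabilityMeasure m] (hstat : Measure.map act (μ.prod m) = m) :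
    ∀ n : ℕ, ∫ w, (∫ x, Real.log ‖Matrix.toEuclideanLin (andersonTransferProd E (padSeq x) n) (w : EuclideanSpace ℝ (Fin 2))‖
        ∂(Measure.pi fun _ : Fin n => μ)) ∂m =
      n * ∫ w, (∫ y, Real.log ‖Matrix.toEuclideanLin (andersonTransferProd E (padSeq y) 1) (w : EuclideanSpace ℝ (Fin 2))‖
        ∂(Measure.pi fun _ : Fin 1 => μ)) ∂m
  | 0 => by
    have h0 : ∀ w : (Metric.sphere (0 : EuclideanSpace ℝ (Fin 2)) 1), (∫ x, Real.log ‖Matrix.toEuclideanLin (andersonTransferProd E (padSeq x) 0) (w : EuclideanSpace ℝ (Fin 2))‖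
        ∂(Measure.pi fun _ : Fin 0 => μ)) = 0 := by
      intro w
      have hw : ‖(w : EuclideanSpace ℝ (Fin 2))‖ = 1 := by simp
      simp only [toEuclideanLin_transferProd_zero, hw, Real.log_one, integral_zero]
    simp_rw [h0]
    simp
  | n + 1 => by
    have IH := integral_logNorm_eq_mul_of_stationary μ hR0 hR E act hact hactm m hstat n
    have hunit : ∀ w : (Metric.sphere (0 : EuclideanSpace ℝ (Fin 2)) 1), ‖(w : EuclideanSpace ℝ (Fin 2))‖ = 1 := fun w => by simp
    -- continuity (hence measurability) and boundedness of g_n on the circle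
    have hgc : ∀ k, Continuous fun w : (Metric.sphere (0 : EuclideanSpace ℝ (Fin 2)) 1) =>
        ∫ x, Real.log ‖Matrix.toEuclideanLin (andersonTransferProd E (padSeq x) k) (w : EuclideanSpace ℝ (Fin 2))‖
          ∂(Measure.pi fun _ : Fin k => μ) :=
      fun k => continuous_sphere_logNormAvg μ hR0 hR E k
    have hgb : ∀ k (w : (Metric.sphere (0 : EuclideanSpace ℝ (Fin 2)) 1)), |∫ x, Real.log ‖Matrix.toEuclideanLin (andersonTransferProd E (padSeq x) k) (w : EuclideanSpace ℝ (Fin 2))‖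
          ∂(Measure.pi fun _ : Fin k => μ)| ≤ k * Real.log (|E| + R + 1) :=
      fun k w => abs_integral_log_norm_transferProd_apply_le μ hR0 hR E k (hunit w)
    -- Step 1: the one-site decomposition, rewritten through `act`
    have hstep : ∀ w : (Metric.sphere (0 : EuclideanSpace ℝ (Fin 2)) 1),
        (∫ z, Real.log ‖Matrix.toEuclideanLin (andersonTransferProd E (padSeq z) (n + 1)) (w : EuclideanSpace ℝ (Fin 2))‖
          ∂(Measure.pi fun _ : Fin (n + 1) => μ)) =
        ∫ a, (Real.log ‖Matrix.toEuclideanLin (andersonTransfer E a) (w : EuclideanSpace ℝ (Fin 2))‖ +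
          ∫ x, Real.log ‖Matrix.toEuclideanLin (andersonTransferProd E (padSeq x) n) ((act (a, w) : (Metric.sphere (0 : EuclideanSpace ℝ (Fin 2)) 1)) : EuclideanSpace ℝ (Fin 2))‖
            ∂(Measure.pi fun _ : Fin n => μ)) ∂μ := by
      intro w
      rw [integral_logNorm_succ_eq_integral_site μ hR0 hR E n (hunit w)]
      simp_rw [hact]
    simp_rw [hstep]
    -- integrability of the two pieces on μ ⊗ m
    have hm1 : Measurable fun p : ℝ × (Metric.sphere (0 : EuclideanSpace ℝ (Fin 2)) 1) =>
        Real.log ‖Matrix.toEuclideanLin (andersonTransfer E p.1) ((p.2 : (Metric.sphere (0 : EuclideanSpace ℝ (Fin 2)) 1)) : EuclideanSpace ℝ (Fin 2))‖ :=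
      (continuous_transfer_apply_sphere E).norm.measurable.log
    have hI1 : Integrable (fun p : ℝ × (Metric.sphere (0 : EuclideanSpace ℝ (Fin 2)) 1) =>
        Real.log ‖Matrix.toEuclideanLin (andersonTransfer E p.1) ((p.2 : (Metric.sphere (0 : EuclideanSpace ℝ (Fin 2)) 1)) : EuclideanSpace ℝ (Fin 2))‖) (μ.prod m) := by
      refine Integrable.of_bound hm1.aestronglyMeasurable (Real.log (|E| + R + 1)) ?_
      filter_upwards [Measure.quasiMeasurePreserving_fst.ae hR] with p hp
      rw [Real.norm_eq_abs]
      exact abs_log_norm_transfer_apply_le hR0 hp (hunit p.2)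
    have hm2 : Measurable fun p : ℝ × (Metric.sphere (0 : EuclideanSpace ℝ (Fin 2)) 1) =>
        ∫ x, Real.log ‖Matrix.toEuclideanLin (andersonTransferProd E (padSeq x) n) ((act p : (Metric.sphere (0 : EuclideanSpace ℝ (Fin 2)) 1)) : EuclideanSpace ℝ (Fin 2))‖
          ∂(Measure.pi fun _ : Fin n => μ) :=
      (hgc n).measurable.comp hactm
    have hI2 : Integrable (fun p : ℝ × (Metric.sphere (0 : EuclideanSpace ℝ (Fin 2)) 1) =>
        ∫ x, Real.log ‖Matrix.toEuclideanLin (andersonTransferProd E (padSeq x) n) ((act p : (Metric.sphere (0 : EuclideanSpace ℝ (Fin 2)) 1)) : EuclideanSpace ℝ (Fin 2))‖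
          ∂(Measure.pi fun _ : Fin n => μ)) (μ.prod m) :=
      Integrable.of_bound hm2.aestronglyMeasurable (n * Real.log (|E| + R + 1))
        (Eventually.of_forall fun p => by rw [Real.norm_eq_abs]; exact hgb n (act p))
    -- swap the order: ∫_m ∫_μ = ∫_{μ ⊗ m}, and split the sum
    have hI12 : Integrable (fun p : ℝ × (Metric.sphere (0 : EuclideanSpace ℝ (Fin 2)) 1) =>
        Real.log ‖Matrix.toEuclideanLin (andersonTransfer E p.1) ((p.2 : (Metric.sphere (0 : EuclideanSpace ℝ (Fin 2)) 1)) : EuclideanSpace ℝ (Fin 2))‖ +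
          ∫ x, Real.log ‖Matrix.toEuclideanLin (andersonTransferProd E (padSeq x) n) ((act p : (Metric.sphere (0 : EuclideanSpace ℝ (Fin 2)) 1)) : EuclideanSpace ℝ (Fin 2))‖
            ∂(Measure.pi fun _ : Fin n => μ)) (μ.prod m) := hI1.add hI2
    have hswap : ∫ w, (∫ a, (Real.log ‖Matrix.toEuclideanLin (andersonTransfer E a) ((w : (Metric.sphere (0 : EuclideanSpace ℝ (Fin 2)) 1)) : EuclideanSpace ℝ (Fin 2))‖ +
          ∫ x, Real.log ‖Matrix.toEuclideanLin (andersonTransferProd E (padSeq x) n) ((act (a, w) : (Metric.sphere (0 : EuclideanSpace ℝ (Fin 2)) 1)) : EuclideanSpace ℝ (Fin 2))‖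
            ∂(Measure.pi fun _ : Fin n => μ)) ∂μ) ∂m =
        ∫ p, (Real.log ‖Matrix.toEuclideanLin (andersonTransfer E p.1) ((p.2 : (Metric.sphere (0 : EuclideanSpace ℝ (Fin 2)) 1)) : EuclideanSpace ℝ (Fin 2))‖ +
          ∫ x, Real.log ‖Matrix.toEuclideanLin (andersonTransferProd E (padSeq x) n) ((act p : (Metric.sphere (0 : EuclideanSpace ℝ (Fin 2)) 1)) : EuclideanSpace ℝ (Fin 2))‖
            ∂(Measure.pi fun _ : Fin n => μ)) ∂(μ.prod m) :=
      (integral_prod_symm _ hI12).symm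
    rw [hswap, integral_add hI1 hI2]
    -- first piece: ∫ g_1 dm
    have hpiece1 : ∫ p, Real.log ‖Matrix.toEuclideanLin (andersonTransfer E p.1) ((p.2 : (Metric.sphere (0 : EuclideanSpace ℝ (Fin 2)) 1)) : EuclideanSpace ℝ (Fin 2))‖ ∂(μ.prod m) =
        ∫ w, (∫ y, Real.log ‖Matrix.toEuclideanLin (andersonTransferProd E (padSeq y) 1) ((w : (Metric.sphere (0 : EuclideanSpace ℝ (Fin 2)) 1)) : EuclideanSpace ℝ (Fin 2))‖
          ∂(Measure.pi fun _ : Fin 1 => μ)) ∂m := by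
      rw [integral_prod_symm _ hI1]
      refine integral_congr_ae (Eventually.of_forall fun w => ?_)
      have key := integral_log_norm_transfer_apply_eq_pi_one μ E ((w : (Metric.sphere (0 : EuclideanSpace ℝ (Fin 2)) 1)) : EuclideanSpace ℝ (Fin 2))
      beta_reduce
      exact key
    -- second piece: stationarity
    have hpiece2 : ∫ p, (∫ x, Real.log ‖Matrix.toEuclideanLin (andersonTransferProd E (padSeq x) n) ((act p : (Metric.sphere (0 : EuclideanSpace ℝ (Fin 2)) 1)) : EuclideanSpace ℝ (Fin 2))‖
          ∂(Measure.pi fun _ : Fin n => μ)) ∂(μ.prod m) =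
        ∫ w, (∫ x, Real.log ‖Matrix.toEuclideanLin (andersonTransferProd E (padSeq x) n) ((w : (Metric.sphere (0 : EuclideanSpace ℝ (Fin 2)) 1)) : EuclideanSpace ℝ (Fin 2))‖
          ∂(Measure.pi fun _ : Fin n => μ)) ∂m := by
      conv_rhs => rw [← hstat]
      rw [integral_map hactm.aemeasurable (hgc n).aestronglyMeasurable]
    rw [hpiece1, hpiece2, IH]
    push_cast
    ring

/-! ### Stationary measures have no atoms (Fürstenberg's lemma for the Anderson matrices) -/

/-- **The shear lemma**: a finite set of unit vectors mapped into itself, up to positive scaling,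
by a non-trivial shear `(x_i, x_j) ↦ (x_i + t x_j, x_j)` lies on the axis `x_j = 0`
(the orbit of any other point is infinite). [folklore] -/
theorem apply_eq_zero_of_shear_mapsTo {F : Set (Metric.sphere (0 : EuclideanSpace ℝ (Fin 2)) 1)} (hF : F.Finite) {i j : Fin 2}
    {t : ℝ} (ht : t ≠ 0)
    (hU : ∀ x ∈ F, ∃ y ∈ F, ∃ c : ℝ, 0 < c ∧
      (y : EuclideanSpace ℝ (Fin 2)) i = c * ((x : EuclideanSpace ℝ (Fin 2)) i + t * (x : EuclideanSpace ℝ (Fin 2)) j) ∧ (y : EuclideanSpace ℝ (Fin 2)) j = c * (x : EuclideanSpace ℝ (Fin 2)) j) :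
    ∀ x ∈ F, (x : EuclideanSpace ℝ (Fin 2)) j = 0 := by
  intro x hx
  by_contra hxj
  -- the self-map of F
  choose ψ hψF hψ using hU
  let Ψ : F → F := fun y => ⟨ψ y y.2, hψF y y.2⟩
  let seq : ℕ → F := fun k => Ψ^[k] ⟨x, hx⟩
  -- invariant: seq k ∝₊ (x_i + k t x_j, x_j)
  have hinv : ∀ k, ∃ c : ℝ, 0 < c ∧ ((seq k : (Metric.sphere (0 : EuclideanSpace ℝ (Fin 2)) 1)) : EuclideanSpace ℝ (Fin 2)) i = c * ((x : EuclideanSpace ℝ (Fin 2)) i + k * t * (x : EuclideanSpace ℝ (Fin 2)) j) ∧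
      ((seq k : (Metric.sphere (0 : EuclideanSpace ℝ (Fin 2)) 1)) : EuclideanSpace ℝ (Fin 2)) j = c * (x : EuclideanSpace ℝ (Fin 2)) j := by
    intro k
    induction k with
    | zero => exact ⟨1, one_pos, by simp [seq], by simp [seq]⟩
    | succ k ih =>
      obtain ⟨c, hc, h1, h2⟩ := ih
      obtain ⟨c', hc', h1', h2'⟩ := hψ (seq k : (Metric.sphere (0 : EuclideanSpace ℝ (Fin 2)) 1)) (seq k).2
      have hs : seq (k + 1) = Ψ (seq k) := by
        simp only [seq, Function.iterate_succ_apply']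
      refine ⟨c' * c, mul_pos hc' hc, ?_, ?_⟩
      · rw [hs]
        change ((ψ (seq k : (Metric.sphere (0 : EuclideanSpace ℝ (Fin 2)) 1)) (seq k).2 : (Metric.sphere (0 : EuclideanSpace ℝ (Fin 2)) 1)) : EuclideanSpace ℝ (Fin 2)) i = _
        rw [h1', h1, h2]; push_cast; ring
      · rw [hs]
        change ((ψ (seq k : (Metric.sphere (0 : EuclideanSpace ℝ (Fin 2)) 1)) (seq k).2 : (Metric.sphere (0 : EuclideanSpace ℝ (Fin 2)) 1)) : EuclideanSpace ℝ (Fin 2)) j = _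
        rw [h2', h2]; ring
  -- the sequence is injective
  have hinj : Function.Injective seq := by
    intro k l hkl
    obtain ⟨c, hc, hk1, hk2⟩ := hinv k
    obtain ⟨d, hd, hl1, hl2⟩ := hinv l
    rw [hkl] at hk1 hk2
    have hcd : c = d := by
      have : c * (x : EuclideanSpace ℝ (Fin 2)) j = d * (x : EuclideanSpace ℝ (Fin 2)) j := by rw [← hk2, ← hl2]
      exact mul_right_cancel₀ hxj this
    subst hcd
    have h3 : (k : ℝ) * t * (x : EuclideanSpace ℝ (Fin 2)) j = (l : ℝ) * t * (x : EuclideanSpace ℝ (Fin 2)) j := by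
      have := hk1.symm.trans hl1
      have h4 : (x : EuclideanSpace ℝ (Fin 2)) i + k * t * (x : EuclideanSpace ℝ (Fin 2)) j = (x : EuclideanSpace ℝ (Fin 2)) i + l * t * (x : EuclideanSpace ℝ (Fin 2)) j :=
        mul_left_cancel₀ hc.ne' this
      linarith
    have h5 : ((k : ℝ) - l) * (t * (x : EuclideanSpace ℝ (Fin 2)) j) = 0 := by linear_combination h3
    rcases mul_eq_zero.mp h5 with h6 | h6
    · exact_mod_cast sub_eq_zero.mp h6
    · exact absurd h6 (mul_ne_zero ht hxj)
  have hinf : (Set.univ : Set F).Infinite :=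
    Set.infinite_of_injective_forall_mem hinj fun _ => Set.mem_univ _
  exact hinf (Set.finite_univ_iff.mpr hF)

/-- The projective action of an invertible matrix is injective on the unit circle. [folklore] -/
theorem eq_of_inv_norm_smul_eq (X : Matrix (Fin 2) (Fin 2) ℝ) (hX : X.det = 1) {w w' : EuclideanSpace ℝ (Fin 2)}
    (hw : ‖w‖ = 1) (hw' : ‖w'‖ = 1)
    (h : ‖Matrix.toEuclideanLin X w‖⁻¹ • Matrix.toEuclideanLin X w =
      ‖Matrix.toEuclideanLin X w'‖⁻¹ • Matrix.toEuclideanLin X w') : w = w' := by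
  have hw0 : w ≠ 0 := by intro h0; rw [h0, norm_zero] at hw; exact zero_ne_one hw
  have hw'0 : w' ≠ 0 := by intro h0; rw [h0, norm_zero] at hw'; exact zero_ne_one hw'
  set u := Matrix.toEuclideanLin X w with hu
  set u' := Matrix.toEuclideanLin X w' with hu'
  have hu0 : u ≠ 0 := toEuclideanLin_ne_zero_of_det X hX hw0
  have hu'0 : u' ≠ 0 := toEuclideanLin_ne_zero_of_det X hX hw'0
  have hnu : 0 < ‖u‖ := norm_pos_iff.mpr hu0
  have hnu' : 0 < ‖u'‖ := norm_pos_iff.mpr hu'0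
  -- u = c u' with c = ‖u‖/‖u'‖
  set c : ℝ := ‖u‖ * ‖u'‖⁻¹ with hc
  have hcpos : 0 < c := by positivity
  have huc : u = c • u' := by
    have := congrArg (fun z => ‖u‖ • z) h
    simp only [smul_smul, mul_inv_cancel₀ hnu.ne', one_smul] at this
    rw [this, hc]
  -- hence X (w - c w') = 0, so w = c w'
  have hzero : Matrix.toEuclideanLin X (w - c • w') = 0 := by
    rw [map_sub, map_smul, ← hu, ← hu', huc, sub_self]
  have hwc : w = c • w' := by
    by_contra hne
    exact toEuclideanLin_ne_zero_of_det X hX (sub_ne_zero.mpr hne) hzero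
  have hc1 : c = 1 := by
    have := congrArg norm hwc
    rw [norm_smul, Real.norm_eq_abs, abs_of_pos hcpos, hw, hw', mul_one] at this
    exact this.symm
  rw [hwc, hc1, one_smul]

/-- **Stationary measures of the Anderson cocycle have no atoms** (Fürstenberg): if the single-site
law charges two points `a₀ ≠ b₀` (both in its support), a probability measure on the circle that is
stationary under the projective action of `M^E(a)`, `a ∼ μ`, has no atoms.  The set `F` of atoms of
maximal mass is finite and invariant under the action of every `a` in the support, hence under the
shears `M(b₀)M(a₀)⁻¹ = [[1, a₀-b₀],[0,1]]` and `M(a₀)⁻¹M(b₀) = [[1,0],[b₀-a₀,1]]`, which forces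
`F ⊆ {±e₁} ∩ {±e₂} = ∅`. [cite: BucajEtAl2019, Thm 2.3 (strong irreducibility of `G_{ν_E}`)] -/
theorem measure_singleton_eq_zero_of_stationary (μ : Measure ℝ) [IsProbabilityMeasure μ]
    {a₀ b₀ : ℝ} (ha₀ : a₀ ∈ μ.support) (hb₀ : b₀ ∈ μ.support) (hab : a₀ ≠ b₀) (E : ℝ)
    (act : ℝ × (Metric.sphere (0 : EuclideanSpace ℝ (Fin 2)) 1) → (Metric.sphere (0 : EuclideanSpace ℝ (Fin 2)) 1))
    (hact : ∀ a (w : (Metric.sphere (0 : EuclideanSpace ℝ (Fin 2)) 1)), (act (a, w) : EuclideanSpace ℝ (Fin 2)) =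
      ‖Matrix.toEuclideanLin (andersonTransfer E a) (w : EuclideanSpace ℝ (Fin 2))‖⁻¹ •
        Matrix.toEuclideanLin (andersonTransfer E a) (w : EuclideanSpace ℝ (Fin 2)))
    (hactc : Continuous act)
    (m : Measure (Metric.sphere (0 : EuclideanSpace ℝ (Fin 2)) 1)) [IsProbabilityMeasure m] (hstat : Measure.map act (μ.prod m) = m) :
    ∀ x : (Metric.sphere (0 : EuclideanSpace ℝ (Fin 2)) 1), m {x} = 0 := by
  have hactm : Measurable act := hactc.measurable
  have hunit : ∀ w : (Metric.sphere (0 : EuclideanSpace ℝ (Fin 2)) 1), ‖(w : EuclideanSpace ℝ (Fin 2))‖ = 1 := fun w => by simp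
  -- injectivity of the action in the circle variable
  have hinj : ∀ (a : ℝ) (w w' : (Metric.sphere (0 : EuclideanSpace ℝ (Fin 2)) 1)), act (a, w) = act (a, w') → w = w' := by
    intro a w w' h
    apply Subtype.ext
    have h' := congrArg (fun z : (Metric.sphere (0 : EuclideanSpace ℝ (Fin 2)) 1) => (z : EuclideanSpace ℝ (Fin 2))) h
    simp only [hact] at h'
    exact eq_of_inv_norm_smul_eq _ (det_andersonTransfer E a) (hunit w) (hunit w') h'
  by_contra hcon
  push Not at hcon
  obtain ⟨x₀, hx₀⟩ := hcon
  have hβ₀ : 0 < m {x₀} := pos_iff_ne_zero.mpr hx₀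
  -- the atoms of mass ≥ m{x₀} form a finite set
  set T : Set (Metric.sphere (0 : EuclideanSpace ℝ (Fin 2)) 1) := {y | m {x₀} ≤ m {y}} with hT
  have hTfin : T.Finite := by
    have := Measure.finite_const_le_meas_of_disjoint_iUnion₀ m hβ₀
      (As := fun y : (Metric.sphere (0 : EuclideanSpace ℝ (Fin 2)) 1) => ({y} : Set (Metric.sphere (0 : EuclideanSpace ℝ (Fin 2)) 1))) (fun y => (measurableSet_singleton y).nullMeasurableSet)
      (fun y y' hyy' => (Set.disjoint_singleton.mpr hyy').aedisjoint) (measure_ne_top m _)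
    exact this
  obtain ⟨x₁, hx₁T, hmax⟩ := Set.exists_max_image T (fun y => m {y}) hTfin
    ⟨x₀, show m {x₀} ≤ m {x₀} from le_rfl⟩
  set β := m {x₁} with hβ
  have hβpos : 0 < β := hβ₀.trans_le hx₁T
  have hle : ∀ y : (Metric.sphere (0 : EuclideanSpace ℝ (Fin 2)) 1), m {y} ≤ β := by
    intro y
    by_cases hy : y ∈ T
    · exact hmax y hy
    · exact (not_le.mp hy).le.trans hx₁T
  set F : Set (Metric.sphere (0 : EuclideanSpace ℝ (Fin 2)) 1) := {y | m {y} = β} with hF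
  have hFT : F ⊆ T := fun y hy => by
    simp only [hF, Set.mem_setOf_eq] at hy; simp only [hT, Set.mem_setOf_eq]; rw [hy]; exact hx₁T
  have hFfin : F.Finite := hTfin.subset hFT
  have hx₁F : x₁ ∈ F := rfl
  -- stationarity on singletons: a.e. `a`, every point of F is hit from F
  have hfib : ∀ y ∈ F, ∀ᵐ a ∂μ, ∃ w ∈ F, act (a, w) = y := by
    intro y hy
    have hS : MeasurableSet (act ⁻¹' {y}) := hactm (measurableSet_singleton y)
    have hmf : Measurable fun a => m (Prod.mk a ⁻¹' (act ⁻¹' {y})) := measurable_measure_prodMk_left hS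
    -- fibres are subsingletons, hence of mass ≤ β
    have hsub : ∀ a, (Prod.mk a ⁻¹' (act ⁻¹' {y})).Subsingleton := by
      intro a w hw w' hw'
      simp only [Set.mem_preimage, Set.mem_singleton_iff] at hw hw'
      exact hinj a w w' (hw.trans hw'.symm)
    have hfle : ∀ a, m (Prod.mk a ⁻¹' (act ⁻¹' {y})) ≤ β := by
      intro a
      rcases (hsub a).eq_empty_or_singleton with h | ⟨w, h⟩
      · rw [h, measure_empty]; exact bot_le
      · rw [h]; exact hle w
    -- total mass identity
    have htot : ∫⁻ a, m (Prod.mk a ⁻¹' (act ⁻¹' {y})) ∂μ = β := by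
      rw [← Measure.prod_apply hS, ← Measure.map_apply hactm (measurableSet_singleton y), hstat]
      exact hy
    have hae : (fun a => m (Prod.mk a ⁻¹' (act ⁻¹' {y}))) =ᵐ[μ] fun _ => β := by
      refine ae_eq_of_ae_le_of_lintegral_le (Eventually.of_forall hfle) ?_ aemeasurable_const ?_
      · rw [htot]; exact measure_ne_top m _
      · rw [htot, lintegral_const]; simp
    filter_upwards [hae] with a ha
    have hne : (Prod.mk a ⁻¹' (act ⁻¹' {y})).Nonempty := by
      by_contra h
      rw [Set.not_nonempty_iff_eq_empty] at h
      have : m (Prod.mk a ⁻¹' (act ⁻¹' {y})) = 0 := by rw [h, measure_empty]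
      rw [this] at ha
      exact hβpos.ne' ha.symm
    obtain ⟨w, hw⟩ := hne
    have hsing : Prod.mk a ⁻¹' (act ⁻¹' {y}) = {w} := (hsub a).eq_singleton_of_mem hw
    refine ⟨w, ?_, by simpa using hw⟩
    show m {w} = β
    rw [← hsing]; exact ha
  -- hence, a.e. `a`, simultaneously for all y ∈ F
  have hfib' : ∀ᵐ a ∂μ, ∀ y ∈ F, ∃ w ∈ F, act (a, w) = y :=
    (eventually_all_finite hFfin).mpr hfib
  -- the set of good `a` is closed, hence contains the support
  set G : Set ℝ := {a | ∀ y ∈ F, ∃ w ∈ F, act (a, w) = y} with hG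
  have hGclosed : IsClosed G := by
    have hrepr : G = ⋂ y ∈ F, ⋃ w ∈ F, {a | act (a, w) = y} := by
      ext a; simp [hG]
    rw [hrepr]
    refine isClosed_biInter fun y _ => hFfin.isClosed_biUnion fun w _ => ?_
    exact isClosed_eq (hactc.comp (continuous_id.prodMk continuous_const)) continuous_const
  have hsuppG : μ.support ⊆ G := Measure.support_subset_of_isClosed hGclosed hfib'
  have hGa := hsuppG ha₀
  have hGb := hsuppG hb₀
  simp only [hG, Set.mem_setOf_eq] at hGa hGb
  -- surjective self-maps of a finite set are bijective: act(a, F) = F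
  have hmaps : ∀ a, (∀ y ∈ F, ∃ w ∈ F, act (a, w) = y) → ∀ w ∈ F, act (a, w) ∈ F := by
    intro a hsurj
    have hsub : F ⊆ (fun w => act (a, w)) '' F := by
      intro y hy
      obtain ⟨w, hw, hwy⟩ := hsurj y hy
      exact ⟨w, hw, hwy⟩
    have heq : F = (fun w => act (a, w)) '' F :=
      Set.eq_of_subset_of_ncard_le hsub (Set.ncard_image_le hFfin) (hFfin.image _)
    intro w hw
    rw [heq]
    exact ⟨w, hw, rfl⟩
  have hmapsb := hmaps b₀ hGb
  -- coordinates of the action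
  have hcoord : ∀ (a : ℝ) (w : (Metric.sphere (0 : EuclideanSpace ℝ (Fin 2)) 1)), ∃ d : ℝ, 0 < d ∧
      ((act (a, w) : (Metric.sphere (0 : EuclideanSpace ℝ (Fin 2)) 1)) : EuclideanSpace ℝ (Fin 2)) 0 = d * ((E - a) * (w : EuclideanSpace ℝ (Fin 2)) 0 - (w : EuclideanSpace ℝ (Fin 2)) 1) ∧
      ((act (a, w) : (Metric.sphere (0 : EuclideanSpace ℝ (Fin 2)) 1)) : EuclideanSpace ℝ (Fin 2)) 1 = d * (w : EuclideanSpace ℝ (Fin 2)) 0 := by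
    intro a w
    have hne : (w : EuclideanSpace ℝ (Fin 2)) ≠ 0 := fun h => by
      have := hunit w; rw [h, norm_zero] at this; exact zero_ne_one this
    have hpos : 0 < ‖Matrix.toEuclideanLin (andersonTransfer E a) (w : EuclideanSpace ℝ (Fin 2))‖ :=
      norm_pos_iff.mpr (toEuclideanLin_ne_zero_of_det _ (det_andersonTransfer E a) hne)
    refine ⟨‖Matrix.toEuclideanLin (andersonTransfer E a) (w : EuclideanSpace ℝ (Fin 2))‖⁻¹, inv_pos.mpr hpos, ?_, ?_⟩
    · rw [hact]; simp only [PiLp.smul_apply, smul_eq_mul, (andersonTransfer_toEuclideanLin_apply E a (w : EuclideanSpace ℝ (Fin 2))).1]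
    · rw [hact]; simp only [PiLp.smul_apply, smul_eq_mul, (andersonTransfer_toEuclideanLin_apply E a (w : EuclideanSpace ℝ (Fin 2))).2]
  -- the upper shear [[1, a₀ - b₀],[0,1]] maps F into F up to scaling ⇒ x_1 = 0 on F
  have hupper : ∀ x ∈ F, ∃ y ∈ F, ∃ c : ℝ, 0 < c ∧
      (y : EuclideanSpace ℝ (Fin 2)) 0 = c * ((x : EuclideanSpace ℝ (Fin 2)) 0 + (a₀ - b₀) * (x : EuclideanSpace ℝ (Fin 2)) 1) ∧ (y : EuclideanSpace ℝ (Fin 2)) 1 = c * (x : EuclideanSpace ℝ (Fin 2)) 1 := by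
    intro x hx
    obtain ⟨w, hwF, hwx⟩ := hGa x hx
    refine ⟨act (b₀, w), hmapsb w hwF, ?_⟩
    obtain ⟨d, hd, hx0, hx1⟩ := hcoord a₀ w
    obtain ⟨d', hd', hy0, hy1⟩ := hcoord b₀ w
    rw [hwx] at hx0 hx1
    refine ⟨d' * d⁻¹, by positivity, ?_, ?_⟩
    · rw [hy0, hx0, hx1]; field_simp; ring
    · rw [hy1, hx1]; field_simp
  have hx1zero : ∀ x ∈ F, (x : EuclideanSpace ℝ (Fin 2)) 1 = 0 :=
    apply_eq_zero_of_shear_mapsTo hFfin (i := 0) (j := 1) (sub_ne_zero.mpr hab) hupper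
  -- the lower shear [[1,0],[b₀ - a₀, 1]] maps F into F up to scaling ⇒ x_0 = 0 on F
  have hlower : ∀ x ∈ F, ∃ y ∈ F, ∃ c : ℝ, 0 < c ∧
      (y : EuclideanSpace ℝ (Fin 2)) 1 = c * ((x : EuclideanSpace ℝ (Fin 2)) 1 + (b₀ - a₀) * (x : EuclideanSpace ℝ (Fin 2)) 0) ∧ (y : EuclideanSpace ℝ (Fin 2)) 0 = c * (x : EuclideanSpace ℝ (Fin 2)) 0 := by
    intro x hx
    have hyF := hmapsb x hx
    obtain ⟨w', hw'F, hw'y⟩ := hGa (act (b₀, x)) hyF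
    refine ⟨w', hw'F, ?_⟩
    obtain ⟨d, hd, hy0, hy1⟩ := hcoord b₀ x
    obtain ⟨d'', hd'', hz0, hz1⟩ := hcoord a₀ w'
    rw [hw'y] at hz0 hz1
    -- from hy1/hz1: w'_0 = (d/d'') x_0 ; from hy0/hz0: (E-a₀) w'_0 - w'_1 = (d/d'') ((E-b₀) x_0 - x_1)
    refine ⟨d * d''⁻¹, by positivity, ?_, ?_⟩
    · have e1 : (w' : EuclideanSpace ℝ (Fin 2)) 0 = d * d''⁻¹ * (x : EuclideanSpace ℝ (Fin 2)) 0 := by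
        rw [hz1] at hy1  -- hy1 : d'' * w'0 = d * x0
        field_simp; linarith
      have e2 : (E - a₀) * (w' : EuclideanSpace ℝ (Fin 2)) 0 - (w' : EuclideanSpace ℝ (Fin 2)) 1 = d * d''⁻¹ * ((E - b₀) * (x : EuclideanSpace ℝ (Fin 2)) 0 - (x : EuclideanSpace ℝ (Fin 2)) 1) := by
        rw [hz0] at hy0
        field_simp; linarith
      rw [e1] at e2
      field_simp
      field_simp at e2
      linarith
    · rw [hz1] at hy1
      field_simp; linarith
  have hx0zero : ∀ x ∈ F, (x : EuclideanSpace ℝ (Fin 2)) 0 = 0 :=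
    apply_eq_zero_of_shear_mapsTo hFfin (i := 1) (j := 0) (sub_ne_zero.mpr hab.symm) hlower
  -- contradiction: x₁ ∈ F is a unit vector with both coordinates zero
  have hns : ‖(x₁ : EuclideanSpace ℝ (Fin 2))‖ ^ 2 = (x₁ : EuclideanSpace ℝ (Fin 2)) 0 ^ 2 + (x₁ : EuclideanSpace ℝ (Fin 2)) 1 ^ 2 := by
    rw [EuclideanSpace.norm_sq_eq]; simp [Fin.sum_univ_two]
  rw [hunit, hx0zero x₁ hx₁F, hx1zero x₁ hx₁F] at hns
  norm_num at hns

/-! ### Every stationary measure attains the Lyapunov exponent: `L ≤ ∫ g_1 dm` -/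

/-- **The cone estimate for one matrix**: if every thin double cone `{v : |v ∧ u| < s}` has
`m`-mass `≤ η`, then for a matrix `X` with `1 ≤ ‖X‖ ≤ e^B` and `‖Xv‖ ≥ e^{-B}` on the circle,
`log ‖X‖ + log(s/2) - 2Bη ≤ ∫ log ‖Xv‖ dm(v)` — the vectors contracted below `‖X‖s/2` lie in one
thin double cone (pair inequality). [folklore] -/
theorem log_norm_add_le_integral_of_cone (m : Measure (Metric.sphere (0 : EuclideanSpace ℝ (Fin 2)) 1)) [IsProbabilityMeasure m] {η s : ℝ}
    (hs0 : 0 < s) (hs2 : s ≤ 2) (hη0 : 0 ≤ η)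
    (hcone : ∀ u : (Metric.sphere (0 : EuclideanSpace ℝ (Fin 2)) 1), m {v : (Metric.sphere (0 : EuclideanSpace ℝ (Fin 2)) 1) | |(v : EuclideanSpace ℝ (Fin 2)) 0 * (u : EuclideanSpace ℝ (Fin 2)) 1 - (v : EuclideanSpace ℝ (Fin 2)) 1 * (u : EuclideanSpace ℝ (Fin 2)) 0| < s} ≤ ENNReal.ofReal η)
    (X : Matrix (Fin 2) (Fin 2) ℝ) {B : ℝ} (hX1 : 1 ≤ ‖X‖) (hXB : Real.log ‖X‖ ≤ B)
    (hlow : ∀ v : (Metric.sphere (0 : EuclideanSpace ℝ (Fin 2)) 1), -B ≤ Real.log ‖Matrix.toEuclideanLin X (v : EuclideanSpace ℝ (Fin 2))‖)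
    (hint : Integrable (fun v : (Metric.sphere (0 : EuclideanSpace ℝ (Fin 2)) 1) => Real.log ‖Matrix.toEuclideanLin X (v : EuclideanSpace ℝ (Fin 2))‖) m) :
    Real.log ‖X‖ + Real.log (s / 2) - 2 * B * η ≤ ∫ v, Real.log ‖Matrix.toEuclideanLin X (v : EuclideanSpace ℝ (Fin 2))‖ ∂m := by
  have hunit : ∀ w : (Metric.sphere (0 : EuclideanSpace ℝ (Fin 2)) 1), ‖(w : EuclideanSpace ℝ (Fin 2))‖ = 1 := fun w => by simp
  have hXpos : 0 < ‖X‖ := one_pos.trans_le hX1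
  have hlogX : 0 ≤ Real.log ‖X‖ := Real.log_nonneg hX1
  have hB : 0 ≤ B := hlogX.trans hXB
  have hls : Real.log (s / 2) ≤ 0 := Real.log_nonpos (by positivity) (by linarith)
  -- the bad set
  set Bad : Set (Metric.sphere (0 : EuclideanSpace ℝ (Fin 2)) 1) := {v | ‖Matrix.toEuclideanLin X (v : EuclideanSpace ℝ (Fin 2))‖ < ‖X‖ * s / 2} with hBad
  have hcont : Continuous fun v : (Metric.sphere (0 : EuclideanSpace ℝ (Fin 2)) 1) => ‖Matrix.toEuclideanLin X (v : EuclideanSpace ℝ (Fin 2))‖ :=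
    ((Matrix.toEuclideanLin X).continuous_of_finiteDimensional.comp continuous_subtype_val).norm
  have hBadm : MeasurableSet Bad := measurableSet_lt hcont.measurable measurable_const
  -- its mass is at most η
  have hBadle : m.real Bad ≤ η := by
    have hle : m Bad ≤ ENNReal.ofReal η := by
      rcases Set.eq_empty_or_nonempty Bad with h | ⟨u, hu⟩
      · rw [h, measure_empty]; exact bot_le
      · refine (measure_mono fun v hv => ?_).trans (hcone u)
        exact abs_wedge_lt_of_norm_apply_lt X hXpos (hunit v) (hunit u) hv hu
    exact (ENNReal.toReal_mono ENNReal.ofReal_ne_top hle).trans_eq (ENNReal.toReal_ofReal hη0)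
  -- pointwise inequality
  have hpt : ∀ v : (Metric.sphere (0 : EuclideanSpace ℝ (Fin 2)) 1), Real.log ‖X‖ + Real.log (s / 2) - 2 * B * Bad.indicator (fun _ => (1 : ℝ)) v ≤
      Real.log ‖Matrix.toEuclideanLin X (v : EuclideanSpace ℝ (Fin 2))‖ := by
    intro v
    by_cases hv : v ∈ Bad
    · rw [Set.indicator_of_mem hv, mul_one]
      linarith [hlow v]
    · rw [Set.indicator_of_notMem hv, mul_zero, sub_zero]
      have hv' : ‖X‖ * s / 2 ≤ ‖Matrix.toEuclideanLin X (v : EuclideanSpace ℝ (Fin 2))‖ := not_lt.mp hv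
      have hpos : 0 < ‖X‖ * s / 2 := by positivity
      calc Real.log ‖X‖ + Real.log (s / 2) = Real.log (‖X‖ * s / 2) := by
            rw [← Real.log_mul hXpos.ne' (by positivity)]; ring_nf
        _ ≤ _ := Real.log_le_log hpos hv'
  have hIi : Integrable (fun v : (Metric.sphere (0 : EuclideanSpace ℝ (Fin 2)) 1) => Real.log ‖X‖ + Real.log (s / 2) -
      2 * B * Bad.indicator (fun _ => (1 : ℝ)) v) m :=
    (integrable_const _).sub (((integrable_const (1 : ℝ)).indicator hBadm).const_mul _)
  calc Real.log ‖X‖ + Real.log (s / 2) - 2 * B * η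
      ≤ Real.log ‖X‖ + Real.log (s / 2) - 2 * B * m.real Bad := by gcongr
    _ = ∫ v, (Real.log ‖X‖ + Real.log (s / 2) - 2 * B * Bad.indicator (fun _ => (1 : ℝ)) v) ∂m := by
        rw [integral_sub (integrable_const _) (((integrable_const (1 : ℝ)).indicator hBadm).const_mul _),
          integral_const, integral_const_mul, integral_indicator_const _ hBadm]
        simp
    _ ≤ _ := integral_mono hIi hint hpt

/-- **Every stationary measure attains the Lyapunov exponent** (the Fürstenberg–Kifer invariance
principle for the Anderson matrices, lower bound): if `μ` charges two points of its (bounded)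
support and `m` is a stationary probability measure on the circle, then
`L(E) ≤ ∫∫ log ‖M^E(a) w‖ dμ(a) dm(w)`.  Proof: `n ∫ g_1 dm = ∫ g_n dm ≥ 𝔼 log‖M_n‖ + log(s/2) - 2n log(|E|+R+1) η`
by the cone estimate (stationary measures having no atoms, thin cones have uniformly small mass),
and `𝔼 log ‖M_n‖ ≥ nL`. [cite: BucajEtAl2019, Thm 2.5 (Fürstenberg–Kifer)] -/
theorem andersonLyapunov_le_integral_of_stationary (μ : Measure ℝ) [IsProbabilityMeasure μ] {R : ℝ}
    (hR0 : 0 ≤ R) (hR : ∀ᵐ x ∂μ, |x| ≤ R) {a₀ b₀ : ℝ} (ha₀ : a₀ ∈ μ.support) (hb₀ : b₀ ∈ μ.support)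
    (hab : a₀ ≠ b₀) (E : ℝ)
    (act : ℝ × (Metric.sphere (0 : EuclideanSpace ℝ (Fin 2)) 1) → (Metric.sphere (0 : EuclideanSpace ℝ (Fin 2)) 1))
    (hact : ∀ a (w : (Metric.sphere (0 : EuclideanSpace ℝ (Fin 2)) 1)), (act (a, w) : EuclideanSpace ℝ (Fin 2)) =
      ‖Matrix.toEuclideanLin (andersonTransfer E a) (w : EuclideanSpace ℝ (Fin 2))‖⁻¹ •
        Matrix.toEuclideanLin (andersonTransfer E a) (w : EuclideanSpace ℝ (Fin 2)))
    (hactc : Continuous act)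
    (m : Measure (Metric.sphere (0 : EuclideanSpace ℝ (Fin 2)) 1)) [IsProbabilityMeasure m] (hstat : Measure.map act (μ.prod m) = m) :
    andersonLyapunov μ E ≤ ∫ w, (∫ y, Real.log ‖Matrix.toEuclideanLin (andersonTransferProd E (padSeq y) 1) (w : EuclideanSpace ℝ (Fin 2))‖
        ∂(Measure.pi fun _ : Fin 1 => μ)) ∂m := by
  have hunit : ∀ w : (Metric.sphere (0 : EuclideanSpace ℝ (Fin 2)) 1), ‖(w : EuclideanSpace ℝ (Fin 2))‖ = 1 := fun w => by simp
  set C := Real.log (|E| + R + 1) with hC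
  have hC0 : 0 ≤ C := Real.log_nonneg (by linarith [abs_nonneg E])
  set Φ := ∫ w, (∫ y, Real.log ‖Matrix.toEuclideanLin (andersonTransferProd E (padSeq y) 1) (w : EuclideanSpace ℝ (Fin 2))‖
        ∂(Measure.pi fun _ : Fin 1 => μ)) ∂m with hΦ
  have hnoatom := measure_singleton_eq_zero_of_stationary μ ha₀ hb₀ hab E act hact hactc m hstat
  have hinv := integral_logNorm_eq_mul_of_stationary μ hR0 hR E act hact hactc.measurable m hstat
  refine le_of_forall_pos_le_add fun ε hε => ?_
  -- choose η, then the cone width s, then the scale n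
  set η : ℝ := ε / (4 * C + 4) with hη
  have hη0 : 0 < η := by positivity
  have hηC : 2 * C * η ≤ ε / 2 := by
    rw [hη, mul_div_assoc', div_le_div_iff₀ (by positivity) (by positivity)]
    nlinarith
  obtain ⟨s₀, hs₀, hcone₀⟩ := exists_forall_measure_wedge_lt_le m hnoatom
    (ENNReal.ofReal_pos.mpr hη0)
  set s := min s₀ 2 with hs
  have hs0 : 0 < s := lt_min hs₀ two_pos
  have hs2 : s ≤ 2 := min_le_right _ _
  have hcone : ∀ u : (Metric.sphere (0 : EuclideanSpace ℝ (Fin 2)) 1), m {v : (Metric.sphere (0 : EuclideanSpace ℝ (Fin 2)) 1) | |(v : EuclideanSpace ℝ (Fin 2)) 0 * (u : EuclideanSpace ℝ (Fin 2)) 1 - (v : EuclideanSpace ℝ (Fin 2)) 1 * (u : EuclideanSpace ℝ (Fin 2)) 0| < s} ≤ ENNReal.ofReal η :=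
    fun u => (measure_mono fun v (hv : _ < s) => hv.trans_le (min_le_left _ _)).trans (hcone₀ u)
  obtain ⟨n, hn⟩ : ∃ n : ℕ, 2 * |Real.log (s / 2)| / ε < n := exists_nat_gt _
  have hn1 : 1 ≤ n + 1 := Nat.le_add_left 1 n
  set N := n + 1 with hN
  have hNpos : (0 : ℝ) < N := by positivity
  have hlogN : |Real.log (s / 2)| / N ≤ ε / 2 := by
    rw [div_le_iff₀ hNpos]
    have : 2 * |Real.log (s / 2)| / ε * ε < N * ε := by
      have hn' : (n : ℝ) < N := by rw [hN]; push_cast; linarith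
      nlinarith [hn, hn']
    rw [div_mul_cancel₀ _ hε.ne'] at this
    linarith
  -- the main finite-volume inequality: a_N + log(s/2) - 2 N C η ≤ ∫ g_N dm = N Φ
  have hbox := ae_pi_abs_le hR N
  have hjoint : Continuous fun p : (Fin N → ℝ) × (Metric.sphere (0 : EuclideanSpace ℝ (Fin 2)) 1) =>
      Real.log ‖Matrix.toEuclideanLin (andersonTransferProd E (padSeq p.1) N) ((p.2 : (Metric.sphere (0 : EuclideanSpace ℝ (Fin 2)) 1)) : EuclideanSpace ℝ (Fin 2))‖ :=
    continuous_prod_sphere_log_norm_apply E N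
  have hI : Integrable (fun p : (Fin N → ℝ) × (Metric.sphere (0 : EuclideanSpace ℝ (Fin 2)) 1) =>
      Real.log ‖Matrix.toEuclideanLin (andersonTransferProd E (padSeq p.1) N) ((p.2 : (Metric.sphere (0 : EuclideanSpace ℝ (Fin 2)) 1)) : EuclideanSpace ℝ (Fin 2))‖)
      ((Measure.pi fun _ : Fin N => μ).prod m) := by
    refine Integrable.of_bound hjoint.measurable.aestronglyMeasurable (N * C) ?_
    filter_upwards [Measure.quasiMeasurePreserving_fst.ae hbox] with p hp
    rw [Real.norm_eq_abs]
    exact abs_log_norm_transferProd_apply_le hR0 hp E (hunit p.2)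
  have hptx : ∀ᵐ x ∂(Measure.pi fun _ : Fin N => μ),
      Real.log ‖andersonTransferProd E (padSeq x) N‖ + Real.log (s / 2) - 2 * (N * C) * η ≤
        ∫ v, Real.log ‖Matrix.toEuclideanLin (andersonTransferProd E (padSeq x) N) ((v : (Metric.sphere (0 : EuclideanSpace ℝ (Fin 2)) 1)) : EuclideanSpace ℝ (Fin 2))‖ ∂m := by
    filter_upwards [hbox] with x hx
    have hX1 := one_le_norm_of_det_eq_one _ (det_andersonTransferProd E (padSeq x) N)
    have hXB : Real.log ‖andersonTransferProd E (padSeq x) N‖ ≤ N * C :=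
      (le_abs_self _).trans (abs_log_norm_transferProd_le hR0 hx E)
    have hlow : ∀ v : (Metric.sphere (0 : EuclideanSpace ℝ (Fin 2)) 1), -(N * C) ≤
        Real.log ‖Matrix.toEuclideanLin (andersonTransferProd E (padSeq x) N) ((v : (Metric.sphere (0 : EuclideanSpace ℝ (Fin 2)) 1)) : EuclideanSpace ℝ (Fin 2))‖ :=
      fun v => (abs_le.mp (abs_log_norm_transferProd_apply_le hR0 hx E (hunit v))).1
    have hcx : Continuous fun v : (Metric.sphere (0 : EuclideanSpace ℝ (Fin 2)) 1) =>
        Real.log ‖Matrix.toEuclideanLin (andersonTransferProd E (padSeq x) N) ((v : (Metric.sphere (0 : EuclideanSpace ℝ (Fin 2)) 1)) : EuclideanSpace ℝ (Fin 2))‖ :=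
      continuous_sphere_log_norm_apply E x
    have hint : Integrable (fun v : (Metric.sphere (0 : EuclideanSpace ℝ (Fin 2)) 1) =>
        Real.log ‖Matrix.toEuclideanLin (andersonTransferProd E (padSeq x) N) ((v : (Metric.sphere (0 : EuclideanSpace ℝ (Fin 2)) 1)) : EuclideanSpace ℝ (Fin 2))‖) m :=
      Integrable.of_bound hcx.measurable.aestronglyMeasurable (N * C)
        (Eventually.of_forall fun v => by
          rw [Real.norm_eq_abs]; exact abs_log_norm_transferProd_apply_le hR0 hx E (hunit v))
    exact log_norm_add_le_integral_of_cone m hs0 hs2 hη0.le hcone _ hX1 hXB hlow hint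
  have h1 : (N : ℝ) * andersonLyapunov μ E ≤
      ∫ x, Real.log ‖andersonTransferProd E (padSeq x) N‖ ∂(Measure.pi fun _ : Fin N => μ) :=
    mul_andersonLyapunov_le_integral μ E hn1
  have hIa := integrable_log_norm_transferProd μ hR0 hR E N
  have h2 : (∫ x, Real.log ‖andersonTransferProd E (padSeq x) N‖ ∂(Measure.pi fun _ : Fin N => μ)) +
      Real.log (s / 2) - 2 * (N * C) * η ≤ N * Φ := by
    have hIl : Integrable (fun x : Fin N → ℝ =>
        Real.log ‖andersonTransferProd E (padSeq x) N‖ + Real.log (s / 2) - 2 * (N * C) * η)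
        (Measure.pi fun _ : Fin N => μ) := (hIa.add (integrable_const _)).sub (integrable_const _)
    have hIr : Integrable (fun x : Fin N → ℝ =>
        ∫ v, Real.log ‖Matrix.toEuclideanLin (andersonTransferProd E (padSeq x) N) ((v : (Metric.sphere (0 : EuclideanSpace ℝ (Fin 2)) 1)) : EuclideanSpace ℝ (Fin 2))‖ ∂m)
        (Measure.pi fun _ : Fin N => μ) := hI.integral_prod_left
    have hm := integral_mono_ae hIl hIr hptx
    have hIa2 : Integrable (fun x : Fin N → ℝ =>
        Real.log ‖andersonTransferProd E (padSeq x) N‖ + Real.log (s / 2)) (Measure.pi fun _ : Fin N => μ) :=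
      hIa.add (integrable_const _)
    have hlhs : (∫ x, (Real.log ‖andersonTransferProd E (padSeq x) N‖ + Real.log (s / 2) - 2 * (N * C) * η)
        ∂(Measure.pi fun _ : Fin N => μ)) =
        (∫ x, Real.log ‖andersonTransferProd E (padSeq x) N‖ ∂(Measure.pi fun _ : Fin N => μ)) +
          Real.log (s / 2) - 2 * (N * C) * η := by
      rw [integral_sub hIa2 (integrable_const (2 * (N * C) * η)),
        integral_add hIa (integrable_const (Real.log (s / 2))), integral_const, integral_const]
      simp
    rw [hlhs] at hm
    have hswap : ∫ x, (∫ v, Real.log ‖Matrix.toEuclideanLin (andersonTransferProd E (padSeq x) N) ((v : (Metric.sphere (0 : EuclideanSpace ℝ (Fin 2)) 1)) : EuclideanSpace ℝ (Fin 2))‖ ∂m)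
        ∂(Measure.pi fun _ : Fin N => μ) =
        ∫ v, (∫ x, Real.log ‖Matrix.toEuclideanLin (andersonTransferProd E (padSeq x) N) ((v : (Metric.sphere (0 : EuclideanSpace ℝ (Fin 2)) 1)) : EuclideanSpace ℝ (Fin 2))‖
          ∂(Measure.pi fun _ : Fin N => μ)) ∂m :=
      integral_integral_swap hI
    rw [hswap, hinv N] at hm
    exact hm
  have key : (andersonLyapunov μ E - Φ - 2 * C * η) * N ≤ |Real.log (s / 2)| := by
    have e : (andersonLyapunov μ E - Φ - 2 * C * η) * N =
        N * andersonLyapunov μ E - N * Φ - 2 * (N * C) * η := by ring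
    rw [e]
    linarith [h1, h2, neg_abs_le (Real.log (s / 2))]
  have key' : andersonLyapunov μ E - Φ - 2 * C * η ≤ |Real.log (s / 2)| / N := by
    rwa [le_div_iff₀ hNpos]
  linarith [key', hlogN, hηC]

/-! ### Cesàro averages of orbit laws, stationary limits, uniform vector growth -/

/-- Integration against a normalised finite sum of probability measures (Cesàro averages of
orbit laws). [folklore] -/
theorem integral_smul_finsetSum_measure {ι : Type*} (s : Finset ι) (ν : ι → Measure (Metric.sphere (0 : EuclideanSpace ℝ (Fin 2)) 1))
    (hν : ∀ i, IsProbabilityMeasure (ν i)) (c : ℝ≥0∞) (f : (Metric.sphere (0 : EuclideanSpace ℝ (Fin 2)) 1) → ℝ) (hfm : Measurable f) {C : ℝ}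
    (hfb : ∀ w, |f w| ≤ C) :
    ∫ w, f w ∂(c • ∑ i ∈ s, ν i) = c.toReal * ∑ i ∈ s, ∫ w, f w ∂(ν i) := by
  have hint : ∀ i ∈ s, Integrable f (ν i) := fun i _ =>
    Integrable.of_bound hfm.aestronglyMeasurable C
      (Eventually.of_forall fun w => by rw [Real.norm_eq_abs]; exact hfb w)
  rw [integral_smul_measure, integral_finsetSum_measure hint, smul_eq_mul]

/-- **Weak limits of asymptotically invariant laws are stationary**: if probability measures `P_k`
on the circle satisfy `|∫ Ph dP_k - ∫ h dP_k| ≤ 2‖h‖/(k+1)` for every bounded continuous `h`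
(`Ph(w) = ∫ h(act(a, w)) dμ(a)` the one-step transition), then every weak subsequential limit `m`
is stationary: `act_*(μ ⊗ m) = m`. [cite: BucajEtAl2019, §2 (stationary measures of `ν_E` on `ℝℙ¹`; Krylov–Bogolyubov)] -/
theorem map_prod_eq_of_tendsto_of_approx (μ : Measure ℝ) [IsProbabilityMeasure μ]
    (act : ℝ × (Metric.sphere (0 : EuclideanSpace ℝ (Fin 2)) 1) → (Metric.sphere (0 : EuclideanSpace ℝ (Fin 2)) 1)) (hactc : Continuous act)
    (P : ℕ → ProbabilityMeasure (Metric.sphere (0 : EuclideanSpace ℝ (Fin 2)) 1)) (mlim : ProbabilityMeasure (Metric.sphere (0 : EuclideanSpace ℝ (Fin 2)) 1)) {ψ : ℕ → ℕ} (hψ : StrictMono ψ)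
    (hconv : Tendsto (P ∘ ψ) atTop (𝓝 mlim))
    (happrox : ∀ (h : (Metric.sphere (0 : EuclideanSpace ℝ (Fin 2)) 1) →ᵇ ℝ) (k : ℕ),
      |(∫ w, (∫ a, h (act (a, w)) ∂μ) ∂(P k : Measure (Metric.sphere (0 : EuclideanSpace ℝ (Fin 2)) 1))) - ∫ w, h w ∂(P k : Measure (Metric.sphere (0 : EuclideanSpace ℝ (Fin 2)) 1))| ≤
        2 * ‖h‖ / (k + 1)) :
    Measure.map act (μ.prod (mlim : Measure (Metric.sphere (0 : EuclideanSpace ℝ (Fin 2)) 1))) = (mlim : Measure (Metric.sphere (0 : EuclideanSpace ℝ (Fin 2)) 1)) := by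
  have hactm : Measurable act := hactc.measurable
  haveI : IsProbabilityMeasure (Measure.map act (μ.prod (mlim : Measure (Metric.sphere (0 : EuclideanSpace ℝ (Fin 2)) 1)))) :=
    Measure.isProbabilityMeasure_map hactm.aemeasurable
  refine ext_of_forall_integral_eq_of_IsFiniteMeasure fun h => ?_
  -- the transition applied to h, as a bounded continuous function
  have hjm : Measurable fun p : ℝ × (Metric.sphere (0 : EuclideanSpace ℝ (Fin 2)) 1) => h (act p) := h.continuous.measurable.comp hactm
  have hPc : Continuous fun w : (Metric.sphere (0 : EuclideanSpace ℝ (Fin 2)) 1) => ∫ a, h (act (a, w)) ∂μ := by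
    refine continuous_of_dominated (bound := fun _ => ‖h‖) ?_ ?_ (integrable_const _) ?_
    · intro w
      exact (h.continuous.measurable.comp (hactm.comp (measurable_id.prodMk measurable_const))).aestronglyMeasurable
    · intro w
      exact Eventually.of_forall fun a => h.norm_coe_le_norm _
    · exact Eventually.of_forall fun a =>
        h.continuous.comp (hactc.comp (continuous_const.prodMk continuous_id))
  set Ph : (Metric.sphere (0 : EuclideanSpace ℝ (Fin 2)) 1) →ᵇ ℝ := BoundedContinuousFunction.mkOfCompact ⟨fun w => ∫ a, h (act (a, w)) ∂μ, hPc⟩ with hPh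
  have hPh_apply : ∀ w, Ph w = ∫ a, h (act (a, w)) ∂μ := fun w => rfl
  -- LHS = ∫ Ph d mlim
  have hI : Integrable (fun p : ℝ × (Metric.sphere (0 : EuclideanSpace ℝ (Fin 2)) 1) => h (act p)) (μ.prod (mlim : Measure (Metric.sphere (0 : EuclideanSpace ℝ (Fin 2)) 1))) :=
    Integrable.of_bound hjm.aestronglyMeasurable ‖h‖ (Eventually.of_forall fun p => h.norm_coe_le_norm _)
  have hlhs : ∫ w, h w ∂(Measure.map act (μ.prod (mlim : Measure (Metric.sphere (0 : EuclideanSpace ℝ (Fin 2)) 1)))) = ∫ w, Ph w ∂(mlim : Measure (Metric.sphere (0 : EuclideanSpace ℝ (Fin 2)) 1)) := by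
    rw [integral_map hactm.aemeasurable h.continuous.measurable.aestronglyMeasurable]
    simp_rw [hPh_apply]
    exact integral_prod_symm _ hI
  rw [hlhs]
  -- both ∫ Ph dP_{ψ i} → ∫ Ph d mlim and ∫ h dP_{ψ i} → ∫ h d mlim, and their difference → 0
  have h1 : Tendsto (fun i => ∫ w, Ph w ∂(P (ψ i) : Measure (Metric.sphere (0 : EuclideanSpace ℝ (Fin 2)) 1))) atTop (𝓝 (∫ w, Ph w ∂(mlim : Measure (Metric.sphere (0 : EuclideanSpace ℝ (Fin 2)) 1)))) :=
    (ProbabilityMeasure.tendsto_iff_forall_integral_tendsto.mp hconv) Ph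
  have h2 : Tendsto (fun i => ∫ w, h w ∂(P (ψ i) : Measure (Metric.sphere (0 : EuclideanSpace ℝ (Fin 2)) 1))) atTop (𝓝 (∫ w, h w ∂(mlim : Measure (Metric.sphere (0 : EuclideanSpace ℝ (Fin 2)) 1)))) :=
    (ProbabilityMeasure.tendsto_iff_forall_integral_tendsto.mp hconv) h
  have h3 : Tendsto (fun i => (∫ w, Ph w ∂(P (ψ i) : Measure (Metric.sphere (0 : EuclideanSpace ℝ (Fin 2)) 1))) - ∫ w, h w ∂(P (ψ i) : Measure (Metric.sphere (0 : EuclideanSpace ℝ (Fin 2)) 1)))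
      atTop (𝓝 0) := by
    have hb : ∀ i, |(∫ w, Ph w ∂(P (ψ i) : Measure (Metric.sphere (0 : EuclideanSpace ℝ (Fin 2)) 1))) - ∫ w, h w ∂(P (ψ i) : Measure (Metric.sphere (0 : EuclideanSpace ℝ (Fin 2)) 1))| ≤
        2 * ‖h‖ / ((ψ i : ℕ) + 1) := fun i => by
      simp_rw [hPh_apply]; exact happrox h (ψ i)
    have hr : Tendsto (fun i : ℕ => 2 * ‖h‖ / ((ψ i : ℕ) + 1 : ℝ)) atTop (𝓝 0) := by
      have h0 : Tendsto (fun k : ℕ => 2 * ‖h‖ / ((k : ℝ) + 1)) atTop (𝓝 0) := by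
        have := tendsto_one_div_add_atTop_nhds_zero_nat.const_mul (2 * ‖h‖)
        simp only [mul_zero] at this
        refine this.congr fun k => ?_
        ring
      exact h0.comp hψ.tendsto_atTop
    exact squeeze_zero_norm (fun i => by rw [Real.norm_eq_abs]; exact hb i) hr
  have h4 : Tendsto (fun i => ∫ w, Ph w ∂(P (ψ i) : Measure (Metric.sphere (0 : EuclideanSpace ℝ (Fin 2)) 1))) atTop (𝓝 (∫ w, h w ∂(mlim : Measure (Metric.sphere (0 : EuclideanSpace ℝ (Fin 2)) 1)))) := by
    have := h2.add h3
    simp only [add_zero] at this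
    refine this.congr fun i => ?_
    ring
  exact tendsto_nhds_unique h1 h4

/-- **Uniform vector growth at one scale** (the contrapositive of the Fürstenberg–Kifer continuity
mechanism for the Anderson matrices): for every `ε > 0` there is a scale `n ≥ 1` with
`𝔼 log ‖M_n^E v‖ ≥ n (L(E) - ε)` for ALL unit vectors `v` simultaneously.  Otherwise the Cesàro
averages of the orbit laws of bad vectors have a weak limit point (compactness of the space of
probability measures on the circle), which is stationary (Krylov–Bogolyubov) with
`∫ g_1 dm ≤ L - ε`, contradicting `L ≤ ∫ g_1 dm` for all stationary measures.
[cite: BucajEtAl2019, Thm 2.5–2.6 (Fürstenberg–Kifer for the Anderson model)] -/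
theorem exists_scale_uniform_vector_growth (μ : Measure ℝ) [IsProbabilityMeasure μ] {R : ℝ}
    (hR0 : 0 ≤ R) (hR : ∀ᵐ x ∂μ, |x| ≤ R) {a₀ b₀ : ℝ} (ha₀ : a₀ ∈ μ.support) (hb₀ : b₀ ∈ μ.support)
    (hab : a₀ ≠ b₀) (E : ℝ) {ε : ℝ} (hε : 0 < ε) :
    ∃ n : ℕ, 1 ≤ n ∧ ∀ w : (Metric.sphere (0 : EuclideanSpace ℝ (Fin 2)) 1), n * (andersonLyapunov μ E - ε) ≤
      ∫ x, Real.log ‖Matrix.toEuclideanLin (andersonTransferProd E (padSeq x) n) (w : EuclideanSpace ℝ (Fin 2))‖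
        ∂(Measure.pi fun _ : Fin n => μ) := by
  have hunit : ∀ w : (Metric.sphere (0 : EuclideanSpace ℝ (Fin 2)) 1), ‖(w : EuclideanSpace ℝ (Fin 2))‖ = 1 := fun w => by simp
  have hne : ∀ w : (Metric.sphere (0 : EuclideanSpace ℝ (Fin 2)) 1), (w : EuclideanSpace ℝ (Fin 2)) ≠ 0 := fun w h => by
    have := hunit w; rw [h, norm_zero] at this; exact zero_ne_one this
  set L := andersonLyapunov μ E with hL
  by_contra hcon
  push Not at hcon
  -- bad unit vectors at every scale k+1
  have hk : ∀ k : ℕ, ∃ w : (Metric.sphere (0 : EuclideanSpace ℝ (Fin 2)) 1),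
      (∫ x, Real.log ‖Matrix.toEuclideanLin (andersonTransferProd E (padSeq x) (k + 1)) (w : EuclideanSpace ℝ (Fin 2))‖
        ∂(Measure.pi fun _ : Fin (k + 1) => μ)) < (k + 1 : ℕ) * (L - ε) :=
    fun k => hcon (k + 1) (Nat.le_add_left 1 k)
  choose v hv using hk
  -- the projective action
  have hT : Continuous fun p : ℝ × (Metric.sphere (0 : EuclideanSpace ℝ (Fin 2)) 1) => Matrix.toEuclideanLin (andersonTransfer E p.1) ((p.2 : (Metric.sphere (0 : EuclideanSpace ℝ (Fin 2)) 1)) : EuclideanSpace ℝ (Fin 2)) :=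
    continuous_transfer_apply_sphere E
  have hTne : ∀ p : ℝ × (Metric.sphere (0 : EuclideanSpace ℝ (Fin 2)) 1), Matrix.toEuclideanLin (andersonTransfer E p.1) ((p.2 : (Metric.sphere (0 : EuclideanSpace ℝ (Fin 2)) 1)) : EuclideanSpace ℝ (Fin 2)) ≠ 0 :=
    fun p => toEuclideanLin_ne_zero_of_det _ (det_andersonTransfer E p.1) (hne p.2)
  have hactV : Continuous fun p : ℝ × (Metric.sphere (0 : EuclideanSpace ℝ (Fin 2)) 1) =>
      ‖Matrix.toEuclideanLin (andersonTransfer E p.1) ((p.2 : (Metric.sphere (0 : EuclideanSpace ℝ (Fin 2)) 1)) : EuclideanSpace ℝ (Fin 2))‖⁻¹ •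
        Matrix.toEuclideanLin (andersonTransfer E p.1) ((p.2 : (Metric.sphere (0 : EuclideanSpace ℝ (Fin 2)) 1)) : EuclideanSpace ℝ (Fin 2)) :=
    (hT.norm.inv₀ fun p => (norm_pos_iff.mpr (hTne p)).ne').smul hT
  have hmemact : ∀ p : ℝ × (Metric.sphere (0 : EuclideanSpace ℝ (Fin 2)) 1),
      ‖Matrix.toEuclideanLin (andersonTransfer E p.1) ((p.2 : (Metric.sphere (0 : EuclideanSpace ℝ (Fin 2)) 1)) : EuclideanSpace ℝ (Fin 2))‖⁻¹ •
        Matrix.toEuclideanLin (andersonTransfer E p.1) ((p.2 : (Metric.sphere (0 : EuclideanSpace ℝ (Fin 2)) 1)) : EuclideanSpace ℝ (Fin 2)) ∈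
          Metric.sphere (0 : EuclideanSpace ℝ (Fin 2)) 1 := fun p => by
    rw [mem_sphere_zero_iff_norm]; exact norm_smul_inv_norm (hTne p)
  let act : ℝ × (Metric.sphere (0 : EuclideanSpace ℝ (Fin 2)) 1) → (Metric.sphere (0 : EuclideanSpace ℝ (Fin 2)) 1) := fun p =>
    ⟨‖Matrix.toEuclideanLin (andersonTransfer E p.1) ((p.2 : (Metric.sphere (0 : EuclideanSpace ℝ (Fin 2)) 1)) : EuclideanSpace ℝ (Fin 2))‖⁻¹ •
      Matrix.toEuclideanLin (andersonTransfer E p.1) ((p.2 : (Metric.sphere (0 : EuclideanSpace ℝ (Fin 2)) 1)) : EuclideanSpace ℝ (Fin 2)), hmemact p⟩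
  have hact : ∀ a (w : (Metric.sphere (0 : EuclideanSpace ℝ (Fin 2)) 1)), (act (a, w) : EuclideanSpace ℝ (Fin 2)) =
      ‖Matrix.toEuclideanLin (andersonTransfer E a) (w : EuclideanSpace ℝ (Fin 2))‖⁻¹ •
        Matrix.toEuclideanLin (andersonTransfer E a) (w : EuclideanSpace ℝ (Fin 2)) := fun a w => rfl
  have hactc : Continuous act := hactV.subtype_mk hmemact
  have hactm : Measurable act := hactc.measurable
  -- the orbit maps of the bad vectors
  have hone : ∀ (k j : ℕ) (x : Fin j → ℝ),
      Matrix.toEuclideanLin (andersonTransferProd E (padSeq x) j) ((v k : (Metric.sphere (0 : EuclideanSpace ℝ (Fin 2)) 1)) : EuclideanSpace ℝ (Fin 2)) ≠ 0 :=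
    fun k j x => toEuclideanLin_ne_zero_of_det _ (det_andersonTransferProd E _ j) (hne (v k))
  have hmemo : ∀ (k j : ℕ) (x : Fin j → ℝ),
      ‖Matrix.toEuclideanLin (andersonTransferProd E (padSeq x) j) ((v k : (Metric.sphere (0 : EuclideanSpace ℝ (Fin 2)) 1)) : EuclideanSpace ℝ (Fin 2))‖⁻¹ •
        Matrix.toEuclideanLin (andersonTransferProd E (padSeq x) j) ((v k : (Metric.sphere (0 : EuclideanSpace ℝ (Fin 2)) 1)) : EuclideanSpace ℝ (Fin 2)) ∈
          Metric.sphere (0 : EuclideanSpace ℝ (Fin 2)) 1 := fun k j x => by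
    rw [mem_sphere_zero_iff_norm]; exact norm_smul_inv_norm (hone k j x)
  let o : ∀ k j : ℕ, (Fin j → ℝ) → (Metric.sphere (0 : EuclideanSpace ℝ (Fin 2)) 1) := fun k j x =>
    ⟨‖Matrix.toEuclideanLin (andersonTransferProd E (padSeq x) j) ((v k : (Metric.sphere (0 : EuclideanSpace ℝ (Fin 2)) 1)) : EuclideanSpace ℝ (Fin 2))‖⁻¹ •
      Matrix.toEuclideanLin (andersonTransferProd E (padSeq x) j) ((v k : (Metric.sphere (0 : EuclideanSpace ℝ (Fin 2)) 1)) : EuclideanSpace ℝ (Fin 2)), hmemo k j x⟩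
  have ho : ∀ k j x, (o k j x : EuclideanSpace ℝ (Fin 2)) =
      ‖Matrix.toEuclideanLin (andersonTransferProd E (padSeq x) j) ((v k : (Metric.sphere (0 : EuclideanSpace ℝ (Fin 2)) 1)) : EuclideanSpace ℝ (Fin 2))‖⁻¹ •
        Matrix.toEuclideanLin (andersonTransferProd E (padSeq x) j) ((v k : (Metric.sphere (0 : EuclideanSpace ℝ (Fin 2)) 1)) : EuclideanSpace ℝ (Fin 2)) := fun k j x => rfl
  have hom : ∀ k j, Measurable (o k j) := by
    intro k j
    have hc : Continuous fun x : Fin j → ℝ =>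
        Matrix.toEuclideanLin (andersonTransferProd E (padSeq x) j) ((v k : (Metric.sphere (0 : EuclideanSpace ℝ (Fin 2)) 1)) : EuclideanSpace ℝ (Fin 2)) :=
      continuous_andersonTransferProd_apply E j _
    have hcV : Continuous fun x : Fin j → ℝ =>
        ‖Matrix.toEuclideanLin (andersonTransferProd E (padSeq x) j) ((v k : (Metric.sphere (0 : EuclideanSpace ℝ (Fin 2)) 1)) : EuclideanSpace ℝ (Fin 2))‖⁻¹ •
          Matrix.toEuclideanLin (andersonTransferProd E (padSeq x) j) ((v k : (Metric.sphere (0 : EuclideanSpace ℝ (Fin 2)) 1)) : EuclideanSpace ℝ (Fin 2)) :=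
      (hc.norm.inv₀ fun x => (norm_pos_iff.mpr (hone k j x)).ne').smul hc
    exact (hcV.subtype_mk (hmemo k j)).measurable
  -- orbit laws and their Cesàro averages
  let ν : ℕ → ℕ → Measure (Metric.sphere (0 : EuclideanSpace ℝ (Fin 2)) 1) := fun k j => Measure.map (o k j) (Measure.pi fun _ : Fin j => μ)
  have hνprob : ∀ k j, IsProbabilityMeasure (ν k j) := fun k j =>
    Measure.isProbabilityMeasure_map (hom k j).aemeasurable
  let mbar : ℕ → Measure (Metric.sphere (0 : EuclideanSpace ℝ (Fin 2)) 1) := fun k => ((k : ℝ≥0∞) + 1)⁻¹ • ∑ j ∈ Finset.range (k + 1), ν k j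
  have hmbar : ∀ k, IsProbabilityMeasure (mbar k) := by
    intro k
    constructor
    simp only [mbar, Measure.smul_apply, Measure.coe_finsetSum, Finset.sum_apply, measure_univ,
      Finset.sum_const, Finset.card_range, smul_eq_mul, nsmul_eq_mul, mul_one]
    have h1 : ((k + 1 : ℕ) : ℝ≥0∞) = (k : ℝ≥0∞) + 1 := by push_cast; ring
    rw [h1]
    exact ENNReal.inv_mul_cancel (by simp) (by simp)
  let P : ℕ → ProbabilityMeasure (Metric.sphere (0 : EuclideanSpace ℝ (Fin 2)) 1) := fun k => ⟨mbar k, hmbar k⟩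
  have hPcoe : ∀ k, (P k : Measure (Metric.sphere (0 : EuclideanSpace ℝ (Fin 2)) 1)) = mbar k := fun k => rfl
  -- the Cesàro integral formula
  have hces : ∀ (k : ℕ) (f : (Metric.sphere (0 : EuclideanSpace ℝ (Fin 2)) 1) → ℝ) (hfm : Measurable f) {C : ℝ} (hfb : ∀ w, |f w| ≤ C),
      ∫ w, f w ∂(P k : Measure (Metric.sphere (0 : EuclideanSpace ℝ (Fin 2)) 1)) =
        ((k : ℝ) + 1)⁻¹ * ∑ j ∈ Finset.range (k + 1), ∫ w, f w ∂(ν k j) := by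
    intro k f hfm C hfb
    rw [hPcoe]
    have := integral_smul_finsetSum_measure (Finset.range (k + 1)) (ν k) (hνprob k)
      (((k : ℝ≥0∞) + 1)⁻¹) f hfm hfb
    rw [this]
    congr 1
    rw [ENNReal.toReal_inv]
    congr 1
  -- (C-a): ∫ g_1 dP_k = g_{k+1}(v_k)/(k+1) < L - ε
  have hg1m : Measurable fun w : (Metric.sphere (0 : EuclideanSpace ℝ (Fin 2)) 1) =>
      ∫ y, Real.log ‖Matrix.toEuclideanLin (andersonTransferProd E (padSeq y) 1) (w : EuclideanSpace ℝ (Fin 2))‖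
        ∂(Measure.pi fun _ : Fin 1 => μ) := (continuous_sphere_logNormAvg μ hR0 hR E 1).measurable
  have hg1b : ∀ w : (Metric.sphere (0 : EuclideanSpace ℝ (Fin 2)) 1), |∫ y, Real.log ‖Matrix.toEuclideanLin (andersonTransferProd E (padSeq y) 1) (w : EuclideanSpace ℝ (Fin 2))‖
      ∂(Measure.pi fun _ : Fin 1 => μ)| ≤ 1 * Real.log (|E| + R + 1) := fun w => by
    have := abs_integral_log_norm_transferProd_apply_le μ hR0 hR E 1 (hunit w)
    simpa using this
  have hCa : ∀ k, ∫ w, (∫ y, Real.log ‖Matrix.toEuclideanLin (andersonTransferProd E (padSeq y) 1) (w : EuclideanSpace ℝ (Fin 2))‖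
      ∂(Measure.pi fun _ : Fin 1 => μ)) ∂(P k : Measure (Metric.sphere (0 : EuclideanSpace ℝ (Fin 2)) 1)) < L - ε := by
    intro k
    rw [hces k _ hg1m hg1b]
    -- telescoping
    set G : ℕ → ℝ := fun j => ∫ x, Real.log ‖Matrix.toEuclideanLin (andersonTransferProd E (padSeq x) j)
      ((v k : (Metric.sphere (0 : EuclideanSpace ℝ (Fin 2)) 1)) : EuclideanSpace ℝ (Fin 2))‖ ∂(Measure.pi fun _ : Fin j => μ) with hG
    have hterm : ∀ j, ∫ w, (∫ y, Real.log ‖Matrix.toEuclideanLin (andersonTransferProd E (padSeq y) 1) (w : EuclideanSpace ℝ (Fin 2))‖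
        ∂(Measure.pi fun _ : Fin 1 => μ)) ∂(ν k j) = G (j + 1) - G j := fun j =>
      integral_orbit_logNormOne μ hR0 hR E (hunit (v k)) j (o k j) (ho k j) (hom k j)
    simp_rw [hterm]
    rw [Finset.sum_range_sub G (k + 1)]
    have hG0 : G 0 = 0 := by
      simp only [hG, toEuclideanLin_transferProd_zero, hunit, Real.log_one, integral_zero]
    rw [hG0, sub_zero]
    have hlt := hv k
    have hk1 : (0 : ℝ) < (k : ℝ) + 1 := by positivity
    rw [inv_mul_lt_iff₀ hk1]
    calc G (k + 1) < ((k + 1 : ℕ) : ℝ) * (L - ε) := hlt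
      _ = ((k : ℝ) + 1) * (L - ε) := by push_cast; ring
  -- (C-b): approximate invariance of P_k
  have hCb : ∀ (h : (Metric.sphere (0 : EuclideanSpace ℝ (Fin 2)) 1) →ᵇ ℝ) (k : ℕ),
      |(∫ w, (∫ a, h (act (a, w)) ∂μ) ∂(P k : Measure (Metric.sphere (0 : EuclideanSpace ℝ (Fin 2)) 1))) - ∫ w, h w ∂(P k : Measure (Metric.sphere (0 : EuclideanSpace ℝ (Fin 2)) 1))| ≤
        2 * ‖h‖ / (k + 1) := by
    intro h k
    have hhm : Measurable (h : (Metric.sphere (0 : EuclideanSpace ℝ (Fin 2)) 1) → ℝ) := h.continuous.measurable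
    have hhb : ∀ w, |h w| ≤ ‖h‖ := fun w => by
      rw [← Real.norm_eq_abs]; exact h.norm_coe_le_norm w
    have hPhm : Measurable fun w : (Metric.sphere (0 : EuclideanSpace ℝ (Fin 2)) 1) => ∫ a, h (act (a, w)) ∂μ :=
      ((hhm.comp hactm).stronglyMeasurable.integral_prod_left').measurable
    have hPhb : ∀ w : (Metric.sphere (0 : EuclideanSpace ℝ (Fin 2)) 1), |∫ a, h (act (a, w)) ∂μ| ≤ ‖h‖ := fun w => by
      have := norm_integral_le_of_norm_le_const (μ := μ) (f := fun a => h (act (a, w))) (C := ‖h‖)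
        (Eventually.of_forall fun a => h.norm_coe_le_norm _)
      simpa [Real.norm_eq_abs] using this
    rw [hces k _ hPhm hPhb, hces k _ hhm hhb, ← mul_sub, ← Finset.sum_sub_distrib]
    set H : ℕ → ℝ := fun j => ∫ w, h w ∂(ν k j) with hH
    have hterm : ∀ j, ∫ w, (∫ a, h (act (a, w)) ∂μ) ∂(ν k j) = H (j + 1) := fun j =>
      integral_orbit_transition μ E (hunit (v k)) j act hact hactm (o k j) (ho k j) (hom k j)
        (o k (j + 1)) (ho k (j + 1)) (hom k (j + 1)) h hhm hhb
    simp_rw [hterm]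
    rw [Finset.sum_range_sub H (k + 1)]
    have hHb : ∀ j, |H j| ≤ ‖h‖ := fun j => by
      haveI := hνprob k j
      have := BoundedContinuousFunction.norm_integral_le_mul_norm (μ := ν k j) h
      rw [Real.norm_eq_abs, probReal_univ, one_mul] at this
      exact this
    have hk1 : (0 : ℝ) < (k : ℝ) + 1 := by positivity
    have hbound : |H (k + 1) - H 0| ≤ 2 * ‖h‖ :=
      calc |H (k + 1) - H 0| ≤ |H (k + 1)| + |H 0| := abs_sub _ _
        _ ≤ ‖h‖ + ‖h‖ := add_le_add (hHb _) (hHb _)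
        _ = 2 * ‖h‖ := by ring
    rw [abs_mul, abs_of_pos (inv_pos.mpr hk1), div_eq_inv_mul]
    exact mul_le_mul_of_nonneg_left hbound (inv_pos.mpr hk1).le
  -- compactness: a weakly convergent subsequence
  obtain ⟨mlim, ψ, hψ, hconv⟩ := SeqCompactSpace.tendsto_subseq P
  have hstat : Measure.map act (μ.prod (mlim : Measure (Metric.sphere (0 : EuclideanSpace ℝ (Fin 2)) 1))) = (mlim : Measure (Metric.sphere (0 : EuclideanSpace ℝ (Fin 2)) 1)) :=
    map_prod_eq_of_tendsto_of_approx μ act hactc P mlim hψ hconv hCb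
  -- the limit has ∫ g_1 d mlim ≤ L - ε ...
  set g1b : (Metric.sphere (0 : EuclideanSpace ℝ (Fin 2)) 1) →ᵇ ℝ := BoundedContinuousFunction.mkOfCompact
    ⟨fun w => ∫ y, Real.log ‖Matrix.toEuclideanLin (andersonTransferProd E (padSeq y) 1) (w : EuclideanSpace ℝ (Fin 2))‖
      ∂(Measure.pi fun _ : Fin 1 => μ), continuous_sphere_logNormAvg μ hR0 hR E 1⟩ with hg1bdef
  have hg1b_apply : ∀ w, g1b w = ∫ y, Real.log ‖Matrix.toEuclideanLin (andersonTransferProd E (padSeq y) 1) (w : EuclideanSpace ℝ (Fin 2))‖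
      ∂(Measure.pi fun _ : Fin 1 => μ) := fun w => rfl
  have hlim1 : Tendsto (fun i => ∫ w, g1b w ∂(P (ψ i) : Measure (Metric.sphere (0 : EuclideanSpace ℝ (Fin 2)) 1))) atTop (𝓝 (∫ w, g1b w ∂(mlim : Measure (Metric.sphere (0 : EuclideanSpace ℝ (Fin 2)) 1)))) :=
    (ProbabilityMeasure.tendsto_iff_forall_integral_tendsto.mp hconv) g1b
  have hle : ∫ w, g1b w ∂(mlim : Measure (Metric.sphere (0 : EuclideanSpace ℝ (Fin 2)) 1)) ≤ L - ε := by
    refine le_of_tendsto' hlim1 fun i => ?_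
    simp_rw [hg1b_apply]
    exact (hCa (ψ i)).le
  -- ... contradicting the invariance principle
  have hge : L ≤ ∫ w, g1b w ∂(mlim : Measure (Metric.sphere (0 : EuclideanSpace ℝ (Fin 2)) 1)) := by
    simp_rw [hg1b_apply]
    exact andersonLyapunov_le_integral_of_stationary μ hR0 hR ha₀ hb₀ hab E act hact hactc
      (mlim : Measure (Metric.sphere (0 : EuclideanSpace ℝ (Fin 2)) 1)) hstat
  linarith

end Stationary

end Literature.Probability.RandomMatrixProducts

end
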